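import Literature.NumberTheory.IwasawaTheory.Greenberg2006.InducedCohomologyComparison
import Literature.NumberTheory.GaloisRepresentations.RestrictionOpenSubgroupIndex
import Literature.NumberTheory.EllipticCurves.KellerYin2024.CharacterModulePrufer
import Literature.NumberTheory.GaloisRepresentations.ContinuousCohomologyTransport
import Literature.NumberTheory.GaloisRepresentations.ConjugationDescent
import Literature.NumberTheory.GaloisRepresentations.ContinuousCohomologyRestrictScalars
import Literature.NumberTheory.IwasawaTheory.Greenberg2006.InducedCohomologyVanishing
import Literature.NumberTheory.EllipticCurves.IwasawaCyclotomicProofs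
import Literature.NumberTheory.EllipticCurves.IwasawaZpRankUpperBoundProofs
import Literature.NumberTheory.EllipticCurves.HeegnerPoints
import Literature.GroupTheory.ProfiniteSubquotients
import HarnessLib

/-!
# LEO(`𝐃_θ`) and `H²(K_Σ/K, 𝐃_θ) = 0` for the twist deformation of a character of order prime to `p`
# — the named remainder `hLEO`, `h2` of the cell's instance theorem DISCHARGED modulo three published
# facts (kernel file, 0 new facts)

Cell `bsd-eis` (FULL-BSD rank ≤ 1 programme, HOME `run/shared/lean/pub/bsd-eis/`), seat `bsd-eis-k5-ty`
gen 11 (typer), executing planner RULING L67 (1)(d) (HOME/STATUS.md 2026-08-27T10:34:47Z): "then the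
KERNEL theorem `twistDeformation_H2_subsingleton_of_character : (T4) → (T3) →
thm3_twistDeformation_cohomology_addEquiv → … → Subsingleton ((twistDeformation S hS κ₁ κ₂ ρ_θ).H 2)`
(Literature-side kernel file next to `TwistDeformation.lean`, 0 facts, typer-admissible like p520619)
⇒ `hLEO` via `isCotorsion_of_subsingleton` and `h2` via `hasCorank_zero_of_subsingleton` — NO base
change (everything inside `Γ_K`)". Crux 2 (`stmt-BirchSwinnertonDyer-19032`), line `halves` v5, stub
`stub_noPseudoNull`, road (γ); THE INSTANCE =
`Summits/…/Theorems/EisensteinPrimesTwistDeformationFullAtSelmer.lean`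
(`twistDeformation_fullAtSelmer_isAlmostDivisible`, k5-c2 p519555), whose NAMED REMAINDER is `hLEO`,
`h2`, `hSel`, `hcfg`; `hcfg` is a one-liner from `prop32_cohomology_isCofinitelyGenerated` (p519514),
`hSel` is the K-Sh bridge (not here); THIS FILE supplies `hLEO` and `h2` for `A := ℚ_p/ℤ_p`,
`ρ₀ := ℚ_p/ℤ_p(θ)` (g10's Prüfer model `QpModZp p`, g11's GLUE `KellerYin2024/CharacterModulePrufer.lean`).

## The printed road (HOME/k5-c2-MEMO-8.md §(LEO); LIT-DOSSIER §87, §89)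

`Ш²(K, Σ, 𝐃_θ) ⊆ H²(K_Σ/K, 𝐃_θ) ≅ H²(K_Σ/K̃_∞, A_θ)` ([Gr4] Thm. 3) `↪ H²(K_Σ/K̃_∞K_θ, ℚ_p/ℤ_p)`
(restriction to the open subgroup `Gal(K_Σ/K̃_∞K_θ)`, of index `#θ(Gal(K_Σ/K̃_∞)) ∣ #im θ` prime to
`p`: Serre I §2.4 Prop. 9, `n · ker Res = 0`, `n ∈ ℤ_pˣ`) `= 0` (weak Leopoldt for `K_θ`: [Gr4]
pp. 343–344 / Nguyen Quang Do 1984 Thm. 2.2, as `K̃_∞K_θ ⊇ K_θ^{cyc}`). In the tree's currency, with NO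
change of base field (the point of RULING L67's option (O2)): `K_θ` never appears as a type; its
absolute Galois group is the OPEN subgroup `U₀ := π⁻¹(ker θ) ≤ Γ_K` (`π : Γ_K ↠ G_{K,S}`), and
`Gal(K_Σ/K̃_∞K_θ) = galoisGroupAbove S (U₀ ⊓ (ker κ₁ ∩ ker κ₂)) = ker θ ⊓ Gal(K_Σ/K̃_∞)`
(`galoisGroupAbove_comap_inf`).

## What is proved (all `theorem`s; the three PUBLISHED named facts enter as hypotheses `hT4 hT3 h3`)

* §1 `totallyDisconnectedSpace_galoisGroupUnramifiedOutside` (`G_{K,S}` is profinite — tree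
  `ProfiniteSubquotients.totallyDisconnectedSpace_quotient`), `isClosed_galoisGroupAbove`,
  `compactSpace_galoisGroupAbove` (`Gal(K_Σ/K_∞)` is a closed, hence profinite, subgroup), and
  `QpModZp.addEquivQuotientSubring` (g10's `QpModZp p` ≃+ p503293's `ℚ_[p] ⧸ PadicInt.subring p`).
* §2 **`restrict_galoisGroupAbove_H2_subsingleton_of_scalar`** — `H²(Gal(K_Σ/K̃_∞), A) = 0` for ANY
  discrete `ℤ_p`-module `A ≃+ ℚ_p/ℤ_p` on which `G_{K,S}` acts through a continuous character
  `θ : G_{K,S} →ₜ* ℤ_pˣ` with `Nat.Coprime #(im θ) p` (`ρ₀ g a = θ g • a`), and its instance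
  **`restrict_galoisGroupAbove_H2_subsingleton_of_character`** — `H²(Gal(K_Σ/K̃_∞), ℚ_p/ℤ_p(θ)) = 0` —
  for `p` odd, `S ⊇ {v ∣ p}` finite, `K̃_∞ = K̄^{ker κ₁ ∩ ker κ₂} ⊇ K^{cyc}` (the χ_p-torsion clause):
  (T4) at (`U₀`, `R := ℤ_p`, `D := A`) →
  transport along `ker(θ|Gal(K_Σ/K̃_∞)) ≃ₜ* galoisGroupAbove S (U₀ ⊓ ⋂ ker κᵢ)`
  (`ContinuousCohomologyTransport.subsingleton_continuousCohomology_of_continuousMulEquiv`) →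
  `ContinuousRep.ext` (the restriction of `ℚ_p/ℤ_p(θ)` to `ker θ` IS the trivial module,
  `QpModZp.characterRep_restrict_eq_trivial`) → (T3) `….injective_of_coprime` on the profinite
  `Gal(K_Σ/K̃_∞)` (kernel open since `im θ` is finite; index `= #im(θ|) ∣ #im θ`, `Subgroup.index_ker`,
  `Subgroup.card_dvd_of_le`).
* §3 **`twistDeformation_H2_subsingleton_of_character`** (Thm. 3 reading `.subsingleton`, p520619)
  ⇒ **`twistDeformation_LEO_of_character`** (`LEO S (twistDeformation S hS κ₁ κ₂ (characterRep p θ))`,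
  = binder `hLEO` VERBATIM) and **`twistDeformation_hasCorank_H2_zero_of_character`**
  (`HasCorank Λ₂ (… .H 2) 0`, = binder `h2` VERBATIM; `IwasawaAlgebra₂ p` unfolds to
  `PowerSeries (PowerSeries ℤ_[p])`, checked).
* §4 the same three for KELLER–YIN's `θ : Γ_K → GL₁(𝒪_{ℚ_p(∅)})` of finite order `n` prime to `p`
  (`stub_noPseudoNull`'s `θ^n = 1`, `0 < n`, `p ∤ n`) unramified outside `S`
  (`h : N_S ≤ ker (unitChar θ)`), at `ρ₀ := characterRepUnramified S θ h` (GLUE p526002):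
  `twistDeformation_{H2_subsingleton,LEO,hasCorank_H2_zero}_of_unitChar`, through
  `range_liftUnramifiedCont_unitChar` and `coprime_card_range_liftUnramifiedCont_unitChar`.
* §5 **`weakLeopoldtAbove_of_facts : (T4) → (T3) → <the registered stub `stub_weakLeopoldtAbove` of
  the skeleton `halves` v6 VERBATIM>`** (planner RULING L69 (2), HOME/STATUS.md 2026-08-27T11:32:43Z:
  "k5-ty g11's (d) kernel theorem states an intermediate theorem whose conclusion and binder ORDER are
  `stub_weakLeopoldtAbove`'s VERBATIM, so the stub closes by `exact k5ty_theorem …`"; = hypothesis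
  `hH2` of `…Theorems.EisensteinPrimesNoPseudoNullOfBridge.noPseudoNull_of_facts_of_weakLeopoldt_of_bridge`,
  p526858): abstract `A` with `Nonempty (A ≃ₗ[ℤ_[p]] QpModZp p)`, abstract scalar `ρ₀`
  (`∀ g, ∃ t : ℤ_pˣ, ∀ a, ρ₀ g a = t • a`) of finite order `n` prime to `p` (`ρ₀ g ^ n = 1`), `K`
  imaginary quadratic and `(κ₁, κ₂)` jointly onto `ℤ_p²`. The reduction to §2: the character of a
  scalar representation (`exists_character_of_scalar`: `θ g` is THE unit with `ρ₀ g = θ g • _`, unique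
  by faithfulness of `A ≃ ℚ_p/ℤ_p` — `eq_zero_of_forall_smul_eq_zero_of_linearEquiv`; a homomorphism;
  CONTINUOUS because its fibres `{g | ∀ a, ρ₀ g a = u • a}` are closed and its range is finite —
  `finite_range_of_pow_eq_one`), `coprime_card_range_of_pow_eq_one` (Cauchy), and the χ_p-torsion
  clause from `IsImaginaryQuadratic K` (`cyclotomicCharacter_mem_torsion_of_mem_multiZpKer`:
  `ker κ₁ ⊓ ker κ₂ ≤ ker κ_cyc`, tree `ZpExtension.kerSubgroup_inf_le_kerSubgroup_of_surjective` —
  Washington Thm. 13.4 for `[K:ℚ] ≤ 2` — and `ZpExtension.exists_isCyclotomic_holds`).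
* §6 **(T3) IS NOT NEEDED — the same road modulo (T4) ALONE.** Serre I §2.4 Prop. 9 in degree 2
  for an open NORMAL subgroup of a profinite group and a discrete module on which the index is
  invertible is ALREADY KERNEL in the tree: `ConjugationDescent.resSubgroup_two_injective` (dimension
  shifting through the `G`- and `N`-acyclic coinduced module `C(G, M)`, over `ℤ`), and ARM P r13's
  `ContinuousRep.subsingleton_H_two_restrictScalars_iff` (p527318) moves `H² = 0` between the
  `ℤ_p`-linear and the `ℤ`-linear cohomology. Hence **`restrict_galoisGroupAbove_H2_subsingleton_of_T4
  (hT4) …`** (general scalar model, NO (T3) binder: (T4) at `R := ℤ` → transport → the kernel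
  `U'' = ker(θ|Gal(K_Σ/K̃_∞))` is open normal of index prime to `p`, which is invertible on the
  `ℤ_p`-module `A` (`bijective_zsmul_of_coprime`) → `resSubgroup_two_injective` → restrict scalars),
  **`twistDeformation_{H2_subsingleton,LEO,hasCorank_H2_zero}_of_T4 (hT4) …`** (general
  scalar model; the `_of_character`/`_of_unitChar` data are instances) and
  **`weakLeopoldtAbove_of_T4 (hT4) : <stub_weakLeopoldtAbove VERBATIM>`**. The (hT3)-variants
  of §2–§5 stay as landed (p529464/p531254); consumers should prefer the §6 names.
INSTANCE BINDERS (no instance is declared in Literature files of this seat): the statements carry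
`[DiscreteTopology (QpModZp p)] [ContinuousSMul ℤ_[p] (QpModZp p)]` — Props, discharged by the
consumer with `QpModZp.discreteTopology p` / `QpModZp.continuousSMul p` (GLUE §1) — and the same
free topologies / `ContinuousSMul` / `IsTopologicalAddGroup` binders on `PowerSeries _` and
`IndModule₂ ℤ_[p] p _` as the instance theorem itself.
HONEST FRAMING: §6 is conditional on (T4) `weakLeopoldt_H2_subsingleton_above_cyclotomic_of_isOpen`
(p528392) ALONE — a PUBLISHED, refereed statement typed as a named fact ([NQD84] Thm. 2.2 + Iwasawa
1973 in [Gr4]'s open-subgroup currency); §2–§5 additionally carry (T3)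
`serre_prop9_ker_res_annihilated_by_index` (p527493) and [Gr4] Thm. 3
`thm3_twistDeformation_cohomology_addEquiv` (p520619), both of which §6 shows to be dispensable here
(their degree-2 cases are the tree's KERNEL theorems `resSubgroup_two_injective` and
`twistDeformation_H_two_subsingleton_of_subsingleton_above`). Closes nothing by itself (`--supports`); BSD is proved for no curve here.
After this file the named remainder of road (γ) is `hSel` (K-Sh, `stub_shapiroBridge`) + the PUB facts
+ instance glue; `stub_weakLeopoldtAbove` is `weakLeopoldtAbove_of_T4 hT4` (one PUB fact).

## References
* [Greenberg2006] R. Greenberg, Doc. Math. Extra Vol. Coates (2006) 335–391 — Thm. 3 p. 342;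
  pp. 343–344 (`D = ℚ_p/ℤ_p`, Hypothesis L); p. 341 L12–16 (`Gal(K_Σ/K_∞)`).
* [SerreGaloisCohomology1997] J.-P. Serre, *Galois Cohomology*, Ch. I §1.1, §2.4 Prop. 9 + Corollaire,
  §2.6 (b) (dimension shifting through induced modules).
* [NguyenQuangDo1984] LNM 1068, Thm. 2.2. [Lim2012PoitouTate] Prop. 5.2.2 (proof of Thm. 3).
* [Greenberg2016Selmer] R. Greenberg, PROMS 188 (2016), §2.2 (LEO), §2.3 (CRK), Prop. 4.1.1 (c), §4.3.
* [KellerYin2024] T. Keller, M. Yin, arXiv:2402.12781v2, §1.1 (`θ`, `(F/𝓞)(θ)`).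
* [NeukirchSchmidtWingberg2008] VIII §3 (`G_S`).
* [Washington1997] L. Washington, *Introduction to Cyclotomic Fields*, GTM 83, Thm. 13.4.
* Cell records: HOME/STATUS.md RULINGS L60 (2), L63 (3), L67, L69 (2), L73 (2); k5-ty g11 FINDING + CORRECTION
  (2026-08-27); HOME/k5-c2-MEMO-8.md §(LEO), MEMO-9 §4; HOME/LIT-DOSSIER.md §87 (+ADD. 1–3), §89;
  skeleton `halves` v6 (HOME/k5-c2-g9/GoodLatticeBDPValue.v6.lean, 3a185c7cc5801c14) stub 5.
-/

noncomputable section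

open scoped Classical
open NumberField IsDedekindDomain Field
open Literature.NumberTheory.GaloisRepresentations
open Literature.NumberTheory.EllipticCurves (ZpExtension)
open Literature.NumberTheory.EllipticCurves.KellerYin2024 (continuousMonoidHom_isOpen_ker_of_finite_range)
open Literature.NumberTheory.IwasawaTheory.Greenberg2016

namespace Literature.NumberTheory.IwasawaTheory.Greenberg2006

/-! ### §1. `G_{K,S}` and `Gal(K_Σ/K_∞)` are profinite; `ℚ_p/ℤ_p` in the two spellings -/

section Profinite

variable {K : Type} [Field K] [NumberField K] (S : Set (HeightOneSpectrum (𝓞 K)))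

/-- `G_{K,S} = Γ_K ⧸ N_S` is totally disconnected (quotient of the profinite `Γ_K` by the CLOSED
normal subgroup `N_S`; tree `ProfiniteSubquotients.totallyDisconnectedSpace_quotient`), hence profinite
(it is compact Hausdorff, `RestrictedRamification`). [cite: SerreGaloisCohomology1997, Ch. I §1.1]
[cite: NeukirchSchmidtWingberg2008, VIII §3] -/
theorem totallyDisconnectedSpace_galoisGroupUnramifiedOutside :
    TotallyDisconnectedSpace (GaloisGroupUnramifiedOutside K S) :=
  Literature.GroupTheory.ProfiniteSubquotients.totallyDisconnectedSpace_quotient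
    (ramificationSubgroup K S) (ramificationSubgroup_isClosed K S)

/-- `Gal(K_Σ/K_∞) = galoisGroupAbove S H ≤ G_{K,S}` is CLOSED for a closed `H ≤ Γ_K` (continuous
image of a compact set in a Hausdorff group). [cite: Greenberg2006, p. 341 L12–16, p. 342 L13–14] -/
theorem isClosed_galoisGroupAbove (H : Subgroup (absoluteGaloisGroup K))
    (hH : IsClosed (H : Set (absoluteGaloisGroup K))) :
    IsClosed ((galoisGroupAbove S H : Subgroup (GaloisGroupUnramifiedOutside K S)) :
      Set (GaloisGroupUnramifiedOutside K S)) := by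
  have h : ((galoisGroupAbove S H : Subgroup (GaloisGroupUnramifiedOutside K S)) :
      Set (GaloisGroupUnramifiedOutside K S)) = toUnramifiedQuot K S '' (H : Set (absoluteGaloisGroup K)) := by
    ext g
    simp [mem_galoisGroupAbove_iff]
  rw [h]
  exact (hH.isCompact.image (continuous_toUnramifiedQuot K S)).isClosed

/-- … hence COMPACT. [cite: Greenberg2006, p. 341 L12–16] -/
theorem compactSpace_galoisGroupAbove (H : Subgroup (absoluteGaloisGroup K))
    (hH : IsClosed (H : Set (absoluteGaloisGroup K))) : CompactSpace (galoisGroupAbove S H) :=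
  isCompact_iff_compactSpace.mp (isClosed_galoisGroupAbove S H hH).isCompact

end Profinite

/-- The Prüfer module in the two spellings of the tree: g10's `QpModZp p = ℚ_p ⧸ (ℤ_p · 1)` (a
`ℤ_p`-module quotient) and p503293's `ℚ_[p] ⧸ (PadicInt.subring p)` (an additive quotient) are the same
group (same subgroup `{‖q‖ ≤ 1}`). [cite: Greenberg2006, pp. 343–344 (`D = ℚ_p/ℤ_p`)] -/
def _root_.Literature.NumberTheory.IwasawaTheory.QpModZp.addEquivQuotientSubring (p : ℕ) [Fact p.Prime] :
    QpModZp p ≃+ ℚ_[p] ⧸ (PadicInt.subring p).toAddSubgroup :=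
  QuotientAddGroup.quotientAddEquivOfEq (M := (1 : Submodule ℤ_[p] ℚ_[p]).toAddSubgroup)
    (N := (PadicInt.subring p).toAddSubgroup) (by
      ext q
      change q ∈ (1 : Submodule ℤ_[p] ℚ_[p]) ↔ q ∈ PadicInt.subring p
      rw [QpModZp.mem_one_iff, PadicInt.mem_subring_iff])

/-! ### §2. The character instance of the LEO road -/

section Character

variable {K : Type} [Field K] [NumberField K] {p : ℕ} [Fact p.Prime]
  {S : Set (HeightOneSpectrum (𝓞 K))}

omit [NumberField K] in
/-- Set-theoretic identity behind the open-subgroup presentation: the image in `G_{K,S}` of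
`π⁻¹(ker θ) ∩ H` is `ker θ ∩ (image of H)`. [cite: Greenberg2006, p. 341 L12–16] -/
theorem galoisGroupAbove_comap_inf (θ : GaloisGroupUnramifiedOutside K S →ₜ* ℤ_[p]ˣ)
    (H : Subgroup (absoluteGaloisGroup K)) :
    galoisGroupAbove S ((θ.toMonoidHom.ker).comap (toUnramifiedQuot K S) ⊓ H) =
      θ.toMonoidHom.ker ⊓ galoisGroupAbove S H := by
  ext g
  simp only [mem_galoisGroupAbove_iff, Subgroup.mem_inf, Subgroup.mem_comap, MonoidHom.mem_ker,
    ContinuousMonoidHom.coe_toMonoidHom]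
  constructor
  · rintro ⟨σ, ⟨hσ, hσH⟩, rfl⟩
    exact ⟨hσ, σ, hσH, rfl⟩
  · rintro ⟨hg, σ, hσH, rfl⟩
    exact ⟨σ, ⟨hg, hσH⟩, rfl⟩

omit [NumberField K] in
/-- A finite-image character has image of non-zero cardinality; the hypothesis
`Nat.Coprime (Nat.card (range θ)) p` of the road therefore forces a FINITE image. [folklore] -/
private theorem finite_range_of_coprime (θ : GaloisGroupUnramifiedOutside K S →ₜ* ℤ_[p]ˣ)
    (hθ : Nat.Coprime (Nat.card θ.toMonoidHom.range) p) : (Set.range θ).Finite := by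
  by_contra hinf
  haveI hinf' : Infinite θ.toMonoidHom.range := by
    have h : ((θ.toMonoidHom.range : Subgroup ℤ_[p]ˣ) : Set ℤ_[p]ˣ).Infinite := by
      rw [MonoidHom.coe_range]; exact hinf
    exact h.to_subtype
  rw [Nat.card_eq_zero_of_infinite, Nat.coprime_zero_left] at hθ
  exact (Fact.out : p.Prime).one_lt.ne' hθ

/-- **The vanishing `H²(K_Σ/K̃_∞, A) = 0` for a corank-one coefficient twisted by a character of
order prime to `p`** — GENERAL SCALAR MODEL: `A` any discrete `ℤ_p`-module additively `≃ ℚ_p/ℤ_p`,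
`ρ₀ : G_{K,S} → Aut(A)` continuous acting through a continuous character `θ : G_{K,S} →ₜ* ℤ_pˣ`
(`ρ₀ g a = θ g • a`) with `#im θ` prime to `p`; `p` odd, `S ⊇ {v ∣ p}` finite,
`K̃_∞ = K̄^{ker κ₁ ∩ ker κ₂} ⊇ K^{cyc}` (the χ_p-torsion clause `hcyc`). Road: weak Leopoldt over `K_θ`
((T4) `weakLeopoldt_H2_subsingleton_above_cyclotomic_of_isOpen` at `U₀ := π⁻¹(ker θ)`, `R := ℤ_p`,
`D := A`) + transport along `Gal(K_Σ/K̃_∞K_θ) ≅ ker(θ|Gal(K_Σ/K̃_∞))` (`ContinuousCohomologyTransport`;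
on that kernel `ρ₀` IS the trivial module) + the prime-to-`p` descent ((T3)
`serre_prop9_ker_res_annihilated_by_index`: the kernel is an OPEN subgroup of the profinite
`Gal(K_Σ/K̃_∞)` of index `#θ(Gal(K_Σ/K̃_∞)) ∣ #im θ`, prime to `p`).
[cite: Greenberg2006, pp. 343–344, Thm. 3 p. 342, p. 342 L2–5 (`ρ₀`, `A`)]
[cite: SerreGaloisCohomology1997, Ch. I §2.4, Proposition 9] -/
theorem restrict_galoisGroupAbove_H2_subsingleton_of_scalar
    (hT4 : weakLeopoldt_H2_subsingleton_above_cyclotomic_of_isOpen)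
    (hT3 : serre_prop9_ker_res_annihilated_by_index)
    (hp : p ≠ 2) (hSf : S.Finite)
    (hS : ∀ v : HeightOneSpectrum (𝓞 K), ((p : ℕ) : 𝓞 K) ∈ v.asIdeal → v ∈ S)
    (κ₁ κ₂ : ZpExtension K p)
    (hcyc : ∀ σ : absoluteGaloisGroup K, σ ∈ multiZpKer p ![κ₁, κ₂] →
      GaloisRep.cyclotomicCharacter K p σ ∈ CommGroup.torsion ℤ_[p]ˣ)
    {A : Type} [AddCommGroup A] [Module ℤ_[p] A] [TopologicalSpace A] [DiscreteTopology A]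
    [ContinuousSMul ℤ_[p] A] (hA : Nonempty (A ≃+ ℚ_[p] ⧸ (PadicInt.subring p).toAddSubgroup))
    (ρ₀ : ContinuousRep (GaloisGroupUnramifiedOutside K S) ℤ_[p] A)
    (θ : GaloisGroupUnramifiedOutside K S →ₜ* ℤ_[p]ˣ)
    (hρ₀ : ∀ (g : GaloisGroupUnramifiedOutside K S) (a : A), ρ₀ g a = ((θ g : ℤ_[p]ˣ) : ℤ_[p]) • a)
    (hθ : Nat.Coprime (Nat.card θ.toMonoidHom.range) p) :
    Subsingleton ((ρ₀.restrict (galoisGroupAboveSubtype S (multiZpKer p ![κ₁, κ₂]))).H 2) := by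
  -- notation
  set Hsub : Subgroup (absoluteGaloisGroup K) := multiZpKer p ![κ₁, κ₂] with hHsub
  set Ginf : Subgroup (GaloisGroupUnramifiedOutside K S) := galoisGroupAbove S Hsub with hGinf
  set ι : Ginf →ₜ* GaloisGroupUnramifiedOutside K S := galoisGroupAboveSubtype S Hsub with hι
  set Kθ : Subgroup (GaloisGroupUnramifiedOutside K S) := θ.toMonoidHom.ker with hKθ
  set U₀ : Subgroup (absoluteGaloisGroup K) := Kθ.comap (toUnramifiedQuot K S) with hU₀
  -- the image of `θ` is finite, its kernel open
  have hfin : (Set.range θ).Finite := finite_range_of_coprime θ hθ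
  have hKθopen : IsOpen (Kθ : Set (GaloisGroupUnramifiedOutside K S)) :=
    continuousMonoidHom_isOpen_ker_of_finite_range θ hfin
  have hU₀open : IsOpen (U₀ : Set (absoluteGaloisGroup K)) :=
    hKθopen.preimage (continuous_toUnramifiedQuot K S)
  have hN : ramificationSubgroup K S ≤ U₀ := fun σ hσ ↦ by
    rw [Subgroup.mem_comap, MonoidHom.mem_ker]
    have h1 : toUnramifiedQuot K S σ = 1 := (QuotientGroup.eq_one_iff σ).mpr hσ
    rw [h1, map_one]
  -- (T4): weak Leopoldt over `K_θ` inside `Γ_K`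
  have hwl : Subsingleton ((ContinuousRep.trivial (galoisGroupAbove S (U₀ ⊓ Hsub)) ℤ_[p] A).H 2) :=
    hT4 K p hp S hSf hS 2 ![κ₁, κ₂] U₀ hU₀open hN (fun σ hσ ↦ hcyc σ hσ.2) ℤ_[p] A hA
  -- the subgroup of `Ginf` killed by `θ`
  set U'' : Subgroup Ginf := (θ.comp ι).toMonoidHom.ker with hU''
  have hU''eq : U'' = (Kθ ⊓ Ginf).subgroupOf Ginf := by
    ext u
    simp only [hU'', MonoidHom.mem_ker, ContinuousMonoidHom.coe_toMonoidHom,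
      Subgroup.mem_subgroupOf, Subgroup.mem_inf, hKθ, SetLike.coe_mem, and_true]
    rfl
  have hU'eq : galoisGroupAbove S (U₀ ⊓ Hsub) = Kθ ⊓ Ginf := galoisGroupAbove_comap_inf θ Hsub
  -- `U'' ≃ₜ* galoisGroupAbove S (U₀ ⊓ Hsub)`
  let e₀ : U'' ≃* (galoisGroupAbove S (U₀ ⊓ Hsub)) :=
    ((MulEquiv.subgroupCongr hU''eq).trans (Subgroup.subgroupOfEquivOfLe inf_le_right)).trans
      (MulEquiv.subgroupCongr hU'eq.symm)
  have he₀ : ∀ u : U'', ((e₀ u : galoisGroupAbove S (U₀ ⊓ Hsub)) : GaloisGroupUnramifiedOutside K S) =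
      ((u : Ginf) : GaloisGroupUnramifiedOutside K S) := fun _ ↦ rfl
  have he₀' : ∀ v : galoisGroupAbove S (U₀ ⊓ Hsub),
      (((e₀.symm v : U'') : Ginf) : GaloisGroupUnramifiedOutside K S) =
        (v : GaloisGroupUnramifiedOutside K S) := fun _ ↦ rfl
  let e : U'' ≃ₜ* (galoisGroupAbove S (U₀ ⊓ Hsub)) :=
    { e₀ with
      continuous_toFun := by
        refine Topology.IsInducing.subtypeVal.continuous_iff.mpr ?_
        show Continuous fun u : U'' ↦
          ((e₀ u : galoisGroupAbove S (U₀ ⊓ Hsub)) : GaloisGroupUnramifiedOutside K S)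
        simp_rw [he₀]
        exact continuous_subtype_val.comp continuous_subtype_val
      continuous_invFun := by
        refine Topology.IsInducing.subtypeVal.continuous_iff.mpr
          (Topology.IsInducing.subtypeVal.continuous_iff.mpr ?_)
        show Continuous fun v : galoisGroupAbove S (U₀ ⊓ Hsub) ↦
          (((e₀.symm v : U'') : Ginf) : GaloisGroupUnramifiedOutside K S)
        simp_rw [he₀']
        exact continuous_subtype_val }
  -- transport the vanishing to `U''` with the trivial action
  have htrivU'' : Subsingleton ((ContinuousRep.trivial U'' ℤ_[p] A).H 2) := by
    haveI : Subsingleton (continuousCohomology 2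
        (ContinuousRep.trivial (galoisGroupAbove S (U₀ ⊓ Hsub)) ℤ_[p] A).toTopRep) := hwl
    exact subsingleton_continuousCohomology_of_continuousMulEquiv e
      (X := (ContinuousRep.trivial U'' ℤ_[p] A).toTopRep)
      (Y := (ContinuousRep.trivial (galoisGroupAbove S (U₀ ⊓ Hsub)) ℤ_[p] A).toTopRep)
      (TopRep.ofHom ⟨ContinuousLinearMap.id ℤ_[p] A, fun _ ↦ rfl⟩)
      (TopRep.ofHom ⟨ContinuousLinearMap.id ℤ_[p] A, fun _ ↦ rfl⟩)
      (fun _ ↦ rfl) 2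
  -- the restriction of `ρ₀` to `U''` IS the trivial module
  have hrestr : (ρ₀.restrict ι).restrict ⟨U''.subtype, continuous_subtype_val⟩ =
      ContinuousRep.trivial U'' ℤ_[p] A := by
    refine ContinuousRep.ext fun u ↦ LinearMap.ext fun a ↦ ?_
    have hu : θ (ι (u : Ginf)) = 1 := u.2
    change ρ₀ (ι (u : Ginf)) a = a
    rw [hρ₀, hu, Units.val_one, one_smul]
  -- (T3): the prime-to-`p` descent from `U''` to `Ginf`
  haveI : CompactSpace Ginf := compactSpace_galoisGroupAbove S Hsub (isClosed_multiZpKer p _)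
  haveI : TotallyDisconnectedSpace (GaloisGroupUnramifiedOutside K S) :=
    totallyDisconnectedSpace_galoisGroupUnramifiedOutside S
  have hU''open : IsOpen (U'' : Set Ginf) := by
    refine continuousMonoidHom_isOpen_ker_of_finite_range (θ.comp ι) (hfin.subset ?_)
    rintro _ ⟨u, rfl⟩
    exact ⟨ι u, rfl⟩
  have hU''cop : Nat.Coprime U''.index p := by
    rw [hU'', Subgroup.index_ker]
    refine Nat.Coprime.coprime_dvd_left (Subgroup.card_dvd_of_le ?_) hθ
    rintro _ ⟨u, rfl⟩
    exact ⟨ι u, rfl⟩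
  have hinj := serre_prop9_ker_res_annihilated_by_index.injective_of_coprime hT3 (p := p) hU''open
    hU''cop (ρ₀.restrict ι) 2
  haveI : Subsingleton (((ρ₀.restrict ι).restrict ⟨U''.subtype, continuous_subtype_val⟩).H 2) := by
    rw [hrestr]; exact htrivU''
  exact hinj.subsingleton

/-- **The vanishing `H²(K_Σ/K̃_∞, ℚ_p/ℤ_p(θ)) = 0` for a character of order prime to `p`** — the
degree-2 cohomology of `Gal(K_Σ/K̃_∞)` with coefficients `A_θ = ℚ_p/ℤ_p(θ)` vanishes, for `p` odd,
`K̃_∞ = K̄^{ker κ₁ ∩ ker κ₂} ⊇ K^{cyc}` and `θ : G_{K,S} → ℤ_pˣ` continuous with `#im θ` prime to `p`: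
weak Leopoldt over `K_θ` ((T4) `weakLeopoldt_H2_subsingleton_above_cyclotomic_of_isOpen` at
`U₀ := π⁻¹(ker θ)`, `R := ℤ_p`, `D := ℚ_p/ℤ_p`) + transport along
`Gal(K_Σ/K̃_∞K_θ) ≅ ker(θ|Gal(K_Σ/K̃_∞))` (`ContinuousCohomologyTransport`) + the prime-to-`p` descent
((T3) `serre_prop9_ker_res_annihilated_by_index`: the kernel is an OPEN subgroup of index
`#θ(Gal(K_Σ/K̃_∞)) ∣ #im θ`, prime to `p`). [cite: Greenberg2006, pp. 343–344, Thm. 3 p. 342]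
[cite: SerreGaloisCohomology1997, Ch. I §2.4, Proposition 9] -/
theorem restrict_galoisGroupAbove_H2_subsingleton_of_character
    (hT4 : weakLeopoldt_H2_subsingleton_above_cyclotomic_of_isOpen)
    (hT3 : serre_prop9_ker_res_annihilated_by_index)
    (hp : p ≠ 2) (hSf : S.Finite)
    (hS : ∀ v : HeightOneSpectrum (𝓞 K), ((p : ℕ) : 𝓞 K) ∈ v.asIdeal → v ∈ S)
    (κ₁ κ₂ : ZpExtension K p)
    (hcyc : ∀ σ : absoluteGaloisGroup K, σ ∈ multiZpKer p ![κ₁, κ₂] →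
      GaloisRep.cyclotomicCharacter K p σ ∈ CommGroup.torsion ℤ_[p]ˣ)
    (θ : GaloisGroupUnramifiedOutside K S →ₜ* ℤ_[p]ˣ)
    (hθ : Nat.Coprime (Nat.card θ.toMonoidHom.range) p)
    [DiscreteTopology (QpModZp p)] [ContinuousSMul ℤ_[p] (QpModZp p)] :
    Subsingleton (((QpModZp.characterRep p θ).restrict
      (galoisGroupAboveSubtype S (multiZpKer p ![κ₁, κ₂]))).H 2) :=
  restrict_galoisGroupAbove_H2_subsingleton_of_scalar hT4 hT3 hp hSf hS κ₁ κ₂ hcyc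
    ⟨QpModZp.addEquivQuotientSubring p⟩ (QpModZp.characterRep p θ) θ
    (QpModZp.characterRep_apply θ) hθ

/-! ### §3. Through [Gr4] Thm. 3: `H²(K_Σ/K, 𝐃_θ) = 0`, hence LEO(`𝐃_θ`) and `corank H² = 0` -/

variable [TopologicalSpace (PowerSeries ℤ_[p])] [TopologicalSpace (PowerSeries (PowerSeries ℤ_[p]))]

/-- **`H²(K_Σ/K, Ind_{K̃_∞/K}(ℚ_p/ℤ_p(θ))) = 0`** for the twist deformation of a character of order prime
to `p` over the `ℤ_p²`-tower `K̃_∞ ⊇ K^{cyc}` of `K` (`κ₁, κ₂` jointly onto `ℤ_p²`): [Gr4] Thm. 3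
(`thm3_twistDeformation_cohomology_addEquiv`, p520619; statement [Gr4], proof [Lim12]) moves the
vanishing of `restrict_galoisGroupAbove_H2_subsingleton_of_character` from `Gal(K_Σ/K̃_∞)` to
`G_{K,S}`. Conditional on the three PUBLISHED named facts (T4), (T3), Thm. 3; everything else is proved.
[cite: Greenberg2006, Thm. 3 p. 342, pp. 343–344] [cite: SerreGaloisCohomology1997, Ch. I §2.4, Proposition 9]
[cite: Greenberg2016Selmer, §2.2 p. 6 L22–30 (LEO), §4.3 p. 20] -/
theorem twistDeformation_H2_subsingleton_of_character
    (hT4 : weakLeopoldt_H2_subsingleton_above_cyclotomic_of_isOpen)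
    (hT3 : serre_prop9_ker_res_annihilated_by_index)
    (h3 : thm3_twistDeformation_cohomology_addEquiv)
    (hp : p ≠ 2) (hSf : S.Finite)
    (hS : ∀ v : HeightOneSpectrum (𝓞 K), ((p : ℕ) : 𝓞 K) ∈ v.asIdeal → v ∈ S)
    {κ₁ κ₂ : ZpExtension K p}
    (hκ : Function.Surjective (fun σ : absoluteGaloisGroup K ↦ (κ₁ σ, κ₂ σ)))
    (hcyc : ∀ σ : absoluteGaloisGroup K, σ ∈ multiZpKer p ![κ₁, κ₂] →
      GaloisRep.cyclotomicCharacter K p σ ∈ CommGroup.torsion ℤ_[p]ˣ)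
    (θ : GaloisGroupUnramifiedOutside K S →ₜ* ℤ_[p]ˣ)
    (hθ : Nat.Coprime (Nat.card θ.toMonoidHom.range) p)
    [DiscreteTopology (QpModZp p)] [ContinuousSMul ℤ_[p] (QpModZp p)]
    [ContinuousSMul (PowerSeries (PowerSeries ℤ_[p])) (IndModule₂ ℤ_[p] p (QpModZp p))] :
    Subsingleton ((twistDeformation S hS κ₁ κ₂ (QpModZp.characterRep p θ)).H 2) :=
  h3.subsingleton hSf hS hκ (QpModZp.characterRep p θ) (QpModZp.exists_pow_zsmul_eq_zero p) 2
    (restrict_galoisGroupAbove_H2_subsingleton_of_character hT4 hT3 hp hSf hS κ₁ κ₂ hcyc θ hθ)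

/-- **LEO(`𝐃_θ`)** — `Ш²(K, Σ, 𝐃_θ)` is `Λ₂`-cotorsion (indeed `0`: it is a submodule of
`H²(K_Σ/K, 𝐃_θ) = 0`) — the binder `hLEO` of the cell's instance theorem
(`…Theorems.EisensteinPrimesTwistDeformationFullAtSelmer.twistDeformation_fullAtSelmer_isAlmostDivisible`)
at `A := ℚ_p/ℤ_p`, `ρ₀ := ℚ_p/ℤ_p(θ)`, DISCHARGED modulo the three published named facts.
[cite: Greenberg2016Selmer, §2.2 p. 6 L22–30 (LEO(𝐃))] [cite: Greenberg2006, pp. 343–344, Thm. 3 p. 342] -/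
theorem twistDeformation_LEO_of_character
    (hT4 : weakLeopoldt_H2_subsingleton_above_cyclotomic_of_isOpen)
    (hT3 : serre_prop9_ker_res_annihilated_by_index)
    (h3 : thm3_twistDeformation_cohomology_addEquiv)
    (hp : p ≠ 2) (hSf : S.Finite)
    (hS : ∀ v : HeightOneSpectrum (𝓞 K), ((p : ℕ) : 𝓞 K) ∈ v.asIdeal → v ∈ S)
    {κ₁ κ₂ : ZpExtension K p}
    (hκ : Function.Surjective (fun σ : absoluteGaloisGroup K ↦ (κ₁ σ, κ₂ σ)))
    (hcyc : ∀ σ : absoluteGaloisGroup K, σ ∈ multiZpKer p ![κ₁, κ₂] →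
      GaloisRep.cyclotomicCharacter K p σ ∈ CommGroup.torsion ℤ_[p]ˣ)
    (θ : GaloisGroupUnramifiedOutside K S →ₜ* ℤ_[p]ˣ)
    (hθ : Nat.Coprime (Nat.card θ.toMonoidHom.range) p)
    [DiscreteTopology (QpModZp p)] [ContinuousSMul ℤ_[p] (QpModZp p)]
    [IsTopologicalAddGroup (IndModule₂ ℤ_[p] p (QpModZp p))]
    [ContinuousSMul (PowerSeries (PowerSeries ℤ_[p])) (IndModule₂ ℤ_[p] p (QpModZp p))] :
    LEO S (twistDeformation S hS κ₁ κ₂ (QpModZp.characterRep p θ)) := by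
  haveI := twistDeformation_H2_subsingleton_of_character hT4 hT3 h3 hp hSf hS hκ hcyc θ hθ
  haveI : Subsingleton (sha2 S (twistDeformation S hS κ₁ κ₂ (QpModZp.characterRep p θ))) :=
    ⟨fun a b ↦ Subtype.ext (Subsingleton.elim _ _)⟩
  exact isCotorsion_of_subsingleton

/-- **`corank_{Λ₂} H²(K_Σ/K, 𝐃_θ) = 0`** — the binder `h2` of the cell's instance theorem at
`A := ℚ_p/ℤ_p`, `ρ₀ := ℚ_p/ℤ_p(θ)`, DISCHARGED modulo the three published named facts.
[cite: Greenberg2016Selmer, §2.3 p. 7 L1–17 (coranks)] [cite: Greenberg2006, pp. 343–344, Thm. 3 p. 342] -/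
theorem twistDeformation_hasCorank_H2_zero_of_character
    (hT4 : weakLeopoldt_H2_subsingleton_above_cyclotomic_of_isOpen)
    (hT3 : serre_prop9_ker_res_annihilated_by_index)
    (h3 : thm3_twistDeformation_cohomology_addEquiv)
    (hp : p ≠ 2) (hSf : S.Finite)
    (hS : ∀ v : HeightOneSpectrum (𝓞 K), ((p : ℕ) : 𝓞 K) ∈ v.asIdeal → v ∈ S)
    {κ₁ κ₂ : ZpExtension K p}
    (hκ : Function.Surjective (fun σ : absoluteGaloisGroup K ↦ (κ₁ σ, κ₂ σ)))
    (hcyc : ∀ σ : absoluteGaloisGroup K, σ ∈ multiZpKer p ![κ₁, κ₂] →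
      GaloisRep.cyclotomicCharacter K p σ ∈ CommGroup.torsion ℤ_[p]ˣ)
    (θ : GaloisGroupUnramifiedOutside K S →ₜ* ℤ_[p]ˣ)
    (hθ : Nat.Coprime (Nat.card θ.toMonoidHom.range) p)
    [DiscreteTopology (QpModZp p)] [ContinuousSMul ℤ_[p] (QpModZp p)]
    [ContinuousSMul (PowerSeries (PowerSeries ℤ_[p])) (IndModule₂ ℤ_[p] p (QpModZp p))] :
    HasCorank (PowerSeries (PowerSeries ℤ_[p]))
      ((twistDeformation S hS κ₁ κ₂ (QpModZp.characterRep p θ)).H 2) 0 := by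
  haveI := twistDeformation_H2_subsingleton_of_character hT4 hT3 h3 hp hSf hS hκ hcyc θ hθ
  exact hasCorank_zero_of_subsingleton

end Character

/-! ### §4. The Keller–Yin character: `θ : Γ_K → GL₁(𝓞)` of finite order prime to `p`,
### unramified outside `S` (GLUE p526002: `unitChar`, `liftUnramifiedCont`, `characterRepUnramified`) -/

section KellerYin

open Literature.NumberTheory.EllipticCurves Literature.NumberTheory.EllipticCurves.KellerYin2024

variable {K : Type} [Field K] [NumberField K] {p : ℕ} [Fact p.Prime]
  (S : Set (HeightOneSpectrum (𝓞 K)))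
  (θ : FramedGaloisRep K (padicCoeffIntegers (∅ : Set (PadicAlgCl p))) 1)

omit [NumberField K] in
/-- The image of the descended character `θ̃ : G_{K,S} → ℤ_pˣ` is the image of `unitChar θ`
(`Γ_K ↠ G_{K,S}`). [cite: NeukirchSchmidtWingberg2008, VIII §3] -/
theorem range_liftUnramifiedCont_unitChar
    (h : ramificationSubgroup K S ≤ (unitChar θ).toMonoidHom.ker) :
    (liftUnramifiedCont S (unitChar θ) h).toMonoidHom.range = (unitChar θ).toMonoidHom.range := by
  ext u
  simp only [MonoidHom.mem_range, ContinuousMonoidHom.coe_toMonoidHom]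
  constructor
  · rintro ⟨g, rfl⟩
    obtain ⟨σ, rfl⟩ := toUnramifiedQuot_surjective K S g
    exact ⟨σ, (liftUnramifiedCont_mk S (unitChar θ) h σ).symm⟩
  · rintro ⟨σ, rfl⟩
    exact ⟨toUnramifiedQuot K S σ, liftUnramifiedCont_mk S (unitChar θ) h σ⟩

omit [NumberField K] in
/-- The order hypothesis of the road for KY's `θ`: from `stub_noPseudoNull`'s `θ^n = 1`, `0 < n`,
`p ∤ n`. [cite: SerreGaloisCohomology1997, Ch. I §2.4 (Corollaire to Prop. 9)] -/
theorem coprime_card_range_liftUnramifiedCont_unitChar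
    (h : ramificationSubgroup K S ≤ (unitChar θ).toMonoidHom.ker) {n : ℕ} (hn : 0 < n)
    (hpn : ¬ p ∣ n) (hθ : ∀ σ : absoluteGaloisGroup K, θ σ ^ n = 1) :
    Nat.Coprime (Nat.card (liftUnramifiedCont S (unitChar θ) h).toMonoidHom.range) p := by
  rw [range_liftUnramifiedCont_unitChar S θ h]
  exact coprime_card_range_unitChar_of_pow_eq_one θ hn hpn hθ

variable [TopologicalSpace (PowerSeries ℤ_[p])] [TopologicalSpace (PowerSeries (PowerSeries ℤ_[p]))]

/-- **`H²(K_Σ/K, 𝐃_θ) = 0` for Keller–Yin's character** `θ : Γ_K → GL₁(𝒪_{ℚ_p(∅)})` of finite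
order `n` prime to `p` (`θ^n = 1`), unramified outside the finite `S ⊇ {v ∣ p}` (`N_S ≤ ker θ`), over
the `ℤ_p²`-tower `K̃_∞ ⊇ K^{cyc}` of `K` (`p` odd): the instance of
`twistDeformation_H2_subsingleton_of_character` at `ρ₀ := characterRepUnramified S θ h` (GLUE p526002),
i.e. at KY's `(F/𝓞)(θ) ≃ ℚ_p/ℤ_p(θ)` (`charModuleEquiv`). [cite: KellerYin2024, §1.1 (arXiv:2402.12781v2 TeX L441–449)]
[cite: Greenberg2006, Thm. 3 p. 342, pp. 343–344] [cite: SerreGaloisCohomology1997, Ch. I §2.4, Proposition 9] -/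
theorem twistDeformation_H2_subsingleton_of_unitChar
    (hT4 : weakLeopoldt_H2_subsingleton_above_cyclotomic_of_isOpen)
    (hT3 : serre_prop9_ker_res_annihilated_by_index)
    (h3 : thm3_twistDeformation_cohomology_addEquiv)
    (hp : p ≠ 2) (hSf : S.Finite)
    (hS : ∀ v : HeightOneSpectrum (𝓞 K), ((p : ℕ) : 𝓞 K) ∈ v.asIdeal → v ∈ S)
    {κ₁ κ₂ : ZpExtension K p}
    (hκ : Function.Surjective (fun σ : absoluteGaloisGroup K ↦ (κ₁ σ, κ₂ σ)))
    (hcyc : ∀ σ : absoluteGaloisGroup K, σ ∈ multiZpKer p ![κ₁, κ₂] →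
      GaloisRep.cyclotomicCharacter K p σ ∈ CommGroup.torsion ℤ_[p]ˣ)
    (h : ramificationSubgroup K S ≤ (unitChar θ).toMonoidHom.ker) {n : ℕ} (hn : 0 < n)
    (hpn : ¬ p ∣ n) (hθ : ∀ σ : absoluteGaloisGroup K, θ σ ^ n = 1)
    [DiscreteTopology (QpModZp p)] [ContinuousSMul ℤ_[p] (QpModZp p)]
    [ContinuousSMul (PowerSeries (PowerSeries ℤ_[p])) (IndModule₂ ℤ_[p] p (QpModZp p))] :
    Subsingleton ((twistDeformation S hS κ₁ κ₂ (characterRepUnramified S θ h)).H 2) :=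
  twistDeformation_H2_subsingleton_of_character hT4 hT3 h3 hp hSf hS hκ hcyc
    (liftUnramifiedCont S (unitChar θ) h)
    (coprime_card_range_liftUnramifiedCont_unitChar S θ h hn hpn hθ)

/-- **LEO(`𝐃_θ`) for Keller–Yin's character** (binder `hLEO` of the instance theorem at
`ρ₀ := characterRepUnramified S θ h`). [cite: Greenberg2016Selmer, §2.2 p. 6 L22–30]
[cite: KellerYin2024, §1.1] [cite: Greenberg2006, Thm. 3 p. 342, pp. 343–344] -/
theorem twistDeformation_LEO_of_unitChar
    (hT4 : weakLeopoldt_H2_subsingleton_above_cyclotomic_of_isOpen)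
    (hT3 : serre_prop9_ker_res_annihilated_by_index)
    (h3 : thm3_twistDeformation_cohomology_addEquiv)
    (hp : p ≠ 2) (hSf : S.Finite)
    (hS : ∀ v : HeightOneSpectrum (𝓞 K), ((p : ℕ) : 𝓞 K) ∈ v.asIdeal → v ∈ S)
    {κ₁ κ₂ : ZpExtension K p}
    (hκ : Function.Surjective (fun σ : absoluteGaloisGroup K ↦ (κ₁ σ, κ₂ σ)))
    (hcyc : ∀ σ : absoluteGaloisGroup K, σ ∈ multiZpKer p ![κ₁, κ₂] →
      GaloisRep.cyclotomicCharacter K p σ ∈ CommGroup.torsion ℤ_[p]ˣ)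
    (h : ramificationSubgroup K S ≤ (unitChar θ).toMonoidHom.ker) {n : ℕ} (hn : 0 < n)
    (hpn : ¬ p ∣ n) (hθ : ∀ σ : absoluteGaloisGroup K, θ σ ^ n = 1)
    [DiscreteTopology (QpModZp p)] [ContinuousSMul ℤ_[p] (QpModZp p)]
    [IsTopologicalAddGroup (IndModule₂ ℤ_[p] p (QpModZp p))]
    [ContinuousSMul (PowerSeries (PowerSeries ℤ_[p])) (IndModule₂ ℤ_[p] p (QpModZp p))] :
    LEO S (twistDeformation S hS κ₁ κ₂ (characterRepUnramified S θ h)) :=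
  twistDeformation_LEO_of_character hT4 hT3 h3 hp hSf hS hκ hcyc (liftUnramifiedCont S (unitChar θ) h)
    (coprime_card_range_liftUnramifiedCont_unitChar S θ h hn hpn hθ)

/-- **`corank H²(K_Σ/K, 𝐃_θ) = 0` for Keller–Yin's character** (binder `h2` of the instance theorem at
`ρ₀ := characterRepUnramified S θ h`). [cite: Greenberg2016Selmer, §2.3 p. 7 L1–17]
[cite: KellerYin2024, §1.1] [cite: Greenberg2006, Thm. 3 p. 342, pp. 343–344] -/
theorem twistDeformation_hasCorank_H2_zero_of_unitChar
    (hT4 : weakLeopoldt_H2_subsingleton_above_cyclotomic_of_isOpen)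
    (hT3 : serre_prop9_ker_res_annihilated_by_index)
    (h3 : thm3_twistDeformation_cohomology_addEquiv)
    (hp : p ≠ 2) (hSf : S.Finite)
    (hS : ∀ v : HeightOneSpectrum (𝓞 K), ((p : ℕ) : 𝓞 K) ∈ v.asIdeal → v ∈ S)
    {κ₁ κ₂ : ZpExtension K p}
    (hκ : Function.Surjective (fun σ : absoluteGaloisGroup K ↦ (κ₁ σ, κ₂ σ)))
    (hcyc : ∀ σ : absoluteGaloisGroup K, σ ∈ multiZpKer p ![κ₁, κ₂] →
      GaloisRep.cyclotomicCharacter K p σ ∈ CommGroup.torsion ℤ_[p]ˣ)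
    (h : ramificationSubgroup K S ≤ (unitChar θ).toMonoidHom.ker) {n : ℕ} (hn : 0 < n)
    (hpn : ¬ p ∣ n) (hθ : ∀ σ : absoluteGaloisGroup K, θ σ ^ n = 1)
    [DiscreteTopology (QpModZp p)] [ContinuousSMul ℤ_[p] (QpModZp p)]
    [ContinuousSMul (PowerSeries (PowerSeries ℤ_[p])) (IndModule₂ ℤ_[p] p (QpModZp p))] :
    HasCorank (PowerSeries (PowerSeries ℤ_[p]))
      ((twistDeformation S hS κ₁ κ₂ (characterRepUnramified S θ h)).H 2) 0 :=
  twistDeformation_hasCorank_H2_zero_of_character hT4 hT3 h3 hp hSf hS hκ hcyc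
    (liftUnramifiedCont S (unitChar θ) h) (coprime_card_range_liftUnramifiedCont_unitChar S θ h hn hpn hθ)

end KellerYin

/-! ### §5. The registered stub `stub_weakLeopoldtAbove` (skeleton `halves` v6, stub 5) VERBATIM
### (planner RULING L69 (2)): abstract scalar model `(A ≃ₗ ℚ_p/ℤ_p, ρ₀, ρ₀ⁿ = 1)`, `K` imaginary quadratic -/

section ScalarModel

variable {p : ℕ} [Fact p.Prime] {G : Type*} [Group G] [TopologicalSpace G]
  {A : Type*} [AddCommGroup A] [Module ℤ_[p] A] [TopologicalSpace A]

omit [TopologicalSpace A] in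
/-- A `ℤ_p`-module isomorphic to `ℚ_p/ℤ_p` is FAITHFUL: a scalar killing it is `0` (it kills every
`t_n = p^{-n}`, tree `QpModZp.eq_zero_of_forall_smul_tgen_eq_zero`). Used to read off THE character of
Greenberg's rank-one `ρ₀` from its action. [cite: Greenberg2006, p. 342 L2–5 (`ρ₀ : Gal(K_Σ/K) → GL₁`, `A ≅ ℚ_p/ℤ_p`)] -/
theorem eq_zero_of_forall_smul_eq_zero_of_linearEquiv (e : A ≃ₗ[ℤ_[p]] QpModZp p) {c : ℤ_[p]}
    (h : ∀ a : A, c • a = 0) : c = 0 :=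
  QpModZp.eq_zero_of_forall_smul_tgen_eq_zero fun n ↦ by
    have h1 := congrArg e (h (e.symm (QpModZp.tgen p n)))
    rwa [map_smul, LinearEquiv.apply_symm_apply, map_zero] at h1

omit [TopologicalSpace A] in
/-- Two units acting alike on `A ≃ ℚ_p/ℤ_p` are equal. [cite: Greenberg2006, p. 342 L2–5] -/
theorem units_eq_of_forall_smul_eq (e : A ≃ₗ[ℤ_[p]] QpModZp p) {u v : ℤ_[p]ˣ}
    (h : ∀ a : A, (u : ℤ_[p]) • a = (v : ℤ_[p]) • a) : u = v := by
  ext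
  rw [← sub_eq_zero]
  exact eq_zero_of_forall_smul_eq_zero_of_linearEquiv e fun a ↦ by rw [sub_smul, h a, sub_self]

omit [TopologicalSpace G] in
/-- A homomorphism `θ : G → ℤ_pˣ` killed by `n > 0` has FINITE image (inside the `n`-th roots of
unity of the domain `ℤ_p`). [cite: SerreGaloisCohomology1997, Ch. I §2.4 (Corollaire to Prop. 9)] -/
theorem finite_range_of_pow_eq_one (θ : G →* ℤ_[p]ˣ) {n : ℕ} (hn : 0 < n)
    (hθ : ∀ g, θ g ^ n = 1) : (Set.range θ).Finite := by
  have hsub : Set.range θ ⊆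
      (Units.val : ℤ_[p]ˣ → ℤ_[p]) ⁻¹' ↑(Polynomial.nthRootsFinset n (1 : ℤ_[p])) := by
    rintro _ ⟨g, rfl⟩
    simp only [Set.mem_preimage, Finset.mem_coe, Polynomial.mem_nthRootsFinset hn]
    rw [← Units.val_pow_eq_pow_val, hθ g, Units.val_one]
  exact ((Finset.finite_toSet _).preimage Units.val_injective.injOn).subset hsub

omit [TopologicalSpace G] in
/-- … and the cardinality of its image is PRIME TO `p` when `p ∤ n` (Cauchy: an element of order `p`
in the image would force `p ∣ n`) — the index hypothesis of the LEO road's descent step.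
[cite: SerreGaloisCohomology1997, Ch. I §2.4 (Corollaire to Prop. 9)] -/
theorem coprime_card_range_of_pow_eq_one (θ : G →* ℤ_[p]ˣ) {n : ℕ} (hn : 0 < n)
    (hpn : ¬ p ∣ n) (hθ : ∀ g, θ g ^ n = 1) : Nat.Coprime (Nat.card θ.range) p := by
  haveI : Finite θ.range := by
    have : ((θ.range : Subgroup ℤ_[p]ˣ) : Set ℤ_[p]ˣ).Finite := by
      rw [MonoidHom.coe_range]; exact finite_range_of_pow_eq_one θ hn hθ
    exact this.to_subtype
  rw [Nat.coprime_comm, (Fact.out : p.Prime).coprime_iff_not_dvd]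
  intro hdvd
  obtain ⟨x, hx⟩ := exists_prime_orderOf_dvd_card' p hdvd
  obtain ⟨g, hgx⟩ := MonoidHom.mem_range.mp x.2
  have hpow : x ^ n = 1 := by
    apply Subtype.ext
    rw [SubgroupClass.coe_pow, ← hgx, OneMemClass.coe_one]
    exact hθ g
  have h1 : orderOf x ∣ n := orderOf_dvd_of_pow_eq_one hpow
  rw [hx] at h1
  exact hpn h1

/-- **The character of a scalar representation.** If a continuous representation `ρ₀` of `G` on a
Hausdorff `ℤ_p`-module `A ≃ ℚ_p/ℤ_p` acts by unit scalars (`∀ g, ∃ t ∈ ℤ_pˣ, ρ₀ g = t • _` — the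
binder `hscalar` of the cell's instance theorem / of `stub_weakLeopoldtAbove`) and `ρ₀ g ^ n = 1`
(`0 < n`), then `ρ₀ g a = θ g • a` for a CONTINUOUS character `θ : G →ₜ* ℤ_pˣ` with `θ ^ n = 1`:
`θ g` is the unit of `hscalar`, unique by faithfulness (`units_eq_of_forall_smul_eq`), whence a
homomorphism; it is continuous because each fibre `θ⁻¹(u) = ⋂ₐ {g | ρ₀ g a = u • a}` is closed
(orbit maps are continuous, `A` Hausdorff) and there are finitely many of them
(`finite_range_of_pow_eq_one`), so each fibre is also open. This is Greenberg's
"`ρ₀ : Gal(K_Σ/K) → GL₁(R)`, `A = 𝓓 ⊗ ρ₀`" read backwards. [cite: Greenberg2006, p. 342 L2–5] -/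
theorem exists_character_of_scalar [T2Space A] (e : A ≃ₗ[ℤ_[p]] QpModZp p)
    (ρ₀ : ContinuousRep G ℤ_[p] A)
    (hscalar : ∀ g : G, ∃ t : ℤ_[p]ˣ, ∀ a : A, ρ₀ g a = (t : ℤ_[p]) • a)
    {n : ℕ} (hn : 0 < n) (hρn : ∀ g : G, ρ₀ g ^ n = 1) :
    ∃ θ : G →ₜ* ℤ_[p]ˣ, (∀ (g : G) (a : A), ρ₀ g a = ((θ g : ℤ_[p]ˣ) : ℤ_[p]) • a) ∧
      ∀ g : G, θ g ^ n = 1 := by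
  choose t ht using hscalar
  have huniq : ∀ {u v : ℤ_[p]ˣ}, (∀ a : A, (u : ℤ_[p]) • a = (v : ℤ_[p]) • a) → u = v :=
    fun h ↦ units_eq_of_forall_smul_eq e h
  -- the character as a homomorphism
  let θ₀ : G →* ℤ_[p]ˣ :=
    { toFun := t
      map_one' := huniq fun a ↦ by
        rw [← ht 1 a, map_one, Module.End.one_apply, Units.val_one, one_smul]
      map_mul' := fun g h ↦ huniq fun a ↦ by
        rw [← ht (g * h) a, map_mul, Module.End.mul_apply, ht h a, map_smul, ht g, Units.val_mul,
          mul_smul, smul_comm] }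
  have hθ₀ : ∀ (g : G) (a : A), ρ₀ g a = ((θ₀ g : ℤ_[p]ˣ) : ℤ_[p]) • a := ht
  have hpow : ∀ g, θ₀ g ^ n = 1 := fun g ↦ by
    rw [← map_pow]
    refine huniq fun a ↦ ?_
    rw [← hθ₀, map_pow, hρn g, Module.End.one_apply, Units.val_one, one_smul]
  -- finitely many closed fibres ⇒ open fibres ⇒ continuous
  have hfin : (Set.range θ₀).Finite := finite_range_of_pow_eq_one θ₀ hn hpow
  have hclosed : ∀ u : ℤ_[p]ˣ, IsClosed (θ₀ ⁻¹' {u}) := fun u ↦ by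
    have hfib : θ₀ ⁻¹' {u} = ⋂ a : A, {g : G | ρ₀ g a = (u : ℤ_[p]) • a} := by
      ext g
      simp only [Set.mem_preimage, Set.mem_singleton_iff, Set.mem_iInter, Set.mem_setOf_eq]
      exact ⟨fun h a ↦ by rw [hθ₀, h], fun h ↦ huniq fun a ↦ by rw [← hθ₀, h a]⟩
    rw [hfib]
    exact isClosed_iInter fun a ↦ isClosed_eq (ρ₀.continuous_apply_left a) continuous_const
  have hopen : ∀ u : ℤ_[p]ˣ, IsOpen (θ₀ ⁻¹' {u}) := fun u ↦ by
    rw [← isClosed_compl_iff]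
    have hfib : (θ₀ ⁻¹' {u})ᶜ = ⋃ v ∈ Set.range θ₀ \ {u}, θ₀ ⁻¹' {v} := by
      ext g
      simp only [Set.mem_compl_iff, Set.mem_preimage, Set.mem_singleton_iff, Set.mem_iUnion,
        Set.mem_sdiff, Set.mem_range, exists_prop]
      exact ⟨fun h ↦ ⟨θ₀ g, ⟨⟨g, rfl⟩, h⟩, rfl⟩, fun ⟨v, ⟨_, hv⟩, hgv⟩ ↦ hgv ▸ hv⟩
    rw [hfib]
    exact (hfin.subset Set.sdiff_subset).isClosed_biUnion fun v _ ↦ hclosed v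
  have hcont : Continuous θ₀ := continuous_def.2 fun s _ ↦ by
    rw [← Set.biUnion_preimage_singleton]
    exact isOpen_biUnion fun u _ ↦ hopen u
  exact ⟨⟨θ₀, hcont⟩, hθ₀, hpow⟩

end ScalarModel

section Verbatim

open Literature.NumberTheory.EllipticCurves

variable {K : Type} [Field K] [NumberField K] {p : ℕ} [Fact p.Prime]

/-- **The χ_p-torsion clause from `K` imaginary quadratic**: if `(κ₁, κ₂) : Γ_K → ℤ_p²` is onto, then
`K̃_∞ = K̄^{ker κ₁ ∩ ker κ₂}` contains `K^{cyc}`, i.e. the cyclotomic character is torsion on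
`ker κ₁ ⊓ ker κ₂` — Washington Thm. 13.4 for `[K:ℚ] ≤ 2` in the tree's form
`ZpExtension.kerSubgroup_inf_le_kerSubgroup_of_surjective` applied to the cyclotomic `ℤ_p`-extension
(`ZpExtension.exists_isCyclotomic_holds`, `ZpExtension.IsCyclotomic`). The hypothesis `hcyc` of §2–§4
at the data of `stub_weakLeopoldtAbove`. [cite: Washington1997, Thm. 13.4]
[cite: Greenberg2006, p. 341 L39–45 (`K_∞ ⊇` the cyclotomic `ℤ_p`-extension)] -/
theorem cyclotomicCharacter_mem_torsion_of_mem_multiZpKer (hK : IsImaginaryQuadratic K)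
    {κ₁ κ₂ : ZpExtension K p}
    (hκ : Function.Surjective fun σ : absoluteGaloisGroup K ↦ (κ₁ σ, κ₂ σ))
    (σ : absoluteGaloisGroup K) (hσ : σ ∈ multiZpKer p ![κ₁, κ₂]) :
    GaloisRep.cyclotomicCharacter K p σ ∈ CommGroup.torsion ℤ_[p]ˣ := by
  obtain ⟨κc, hκc⟩ := ZpExtension.exists_isCyclotomic_holds K p
    (GaloisRep.cyclotomicCharacter_range_infinite K p)
  have hle := ZpExtension.kerSubgroup_inf_le_kerSubgroup_of_surjective hK.1.le hκ κc
  rw [multiZpKer_pair_eq_inf] at hσ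
  have hmem : σ ∈ κc.kerSubgroup := hle hσ
  rw [hκc, Subgroup.mem_comap] at hmem
  exact hmem

/-- **Weak Leopoldt above `K̃_∞` for a corank-one coefficient twisted by a character of order prime to
`p` — the registered stub `stub_weakLeopoldtAbove` of the skeleton `halves` v6 (stub 5), VERBATIM in
conclusion and binder order, from the two published facts (T4), (T3)** (planner RULING L69 (2); =
hypothesis `hH2` of `noPseudoNull_of_facts_of_weakLeopoldt_of_bridge`, p526858): for `2 < p`, `K`
imaginary quadratic, `S ⊇ {v ∣ p}` finite, `(κ₁, κ₂)` jointly onto `ℤ_p²`, `A ≃ₗ[ℤ_p] ℚ_p/ℤ_p`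
discrete, `ρ₀ : G_{K,S} → Aut A` continuous acting by unit scalars with `ρ₀ⁿ = 1`, `0 < n`, `p ∤ n`:
`H²(Gal(K_Σ/K̃_∞), A) = 0`. Proof = §2's general scalar form at THE character of `ρ₀`
(`exists_character_of_scalar`), the Cauchy count (`coprime_card_range_of_pow_eq_one`) and the
χ_p-torsion clause (`cyclotomicCharacter_mem_torsion_of_mem_multiZpKer`). The closer of the stub is
`exact weakLeopoldtAbove_of_facts hT4 hT3`. Conditional on (T4)
`weakLeopoldt_H2_subsingleton_above_cyclotomic_of_isOpen` ([Gr4] pp. 343–344 = [NQD84] Thm. 2.2 +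
Iwasawa 1973 Thm. 4, p528392) and (T3) `serre_prop9_ker_res_annihilated_by_index` (Serre I §2.4 Prop. 9,
p527493), both PUBLISHED and refereed; nothing else is assumed. [cite: Greenberg2006, pp. 343–344, Thm. 3 p. 342]
[cite: NguyenQuangDo1984, Thm. 2.2] [cite: SerreGaloisCohomology1997, Ch. I §2.4, Proposition 9]
[cite: Washington1997, Thm. 13.4] -/
theorem weakLeopoldtAbove_of_facts
    (hT4 : weakLeopoldt_H2_subsingleton_above_cyclotomic_of_isOpen)
    (hT3 : serre_prop9_ker_res_annihilated_by_index) :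
    ∀ (p : ℕ) [Fact p.Prime] (K : Type) [Field K] [NumberField K], 2 < p →
      IsImaginaryQuadratic K →
      ∀ (S : Set (HeightOneSpectrum (𝓞 K))), S.Finite →
        (∀ v : HeightOneSpectrum (𝓞 K), ((p : ℕ) : 𝓞 K) ∈ v.asIdeal → v ∈ S) →
      ∀ (κ₁ κ₂ : ZpExtension K p),
        (Function.Surjective fun σ : absoluteGaloisGroup K ↦ (κ₁ σ, κ₂ σ)) →
      ∀ (A : Type) [AddCommGroup A] [Module ℤ_[p] A] [TopologicalSpace A] [DiscreteTopology A]
        [ContinuousSMul ℤ_[p] A], Nonempty (A ≃ₗ[ℤ_[p]] QpModZp p) →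
      ∀ (ρ₀ : ContinuousRep (GaloisGroupUnramifiedOutside K S) ℤ_[p] A) (n : ℕ), 0 < n → ¬ p ∣ n →
        (∀ g : GaloisGroupUnramifiedOutside K S, ∃ t : ℤ_[p]ˣ, ∀ a : A, ρ₀ g a = (t : ℤ_[p]) • a) →
        (∀ g : GaloisGroupUnramifiedOutside K S, ρ₀ g ^ n = 1) →
      Subsingleton ((ρ₀.restrict (galoisGroupAboveSubtype S (multiZpKer p ![κ₁, κ₂]))).H 2) := by
  intro p _ K _ _ hp hK S hSf hS κ₁ κ₂ hκ A _ _ _ _ _ hA ρ₀ n hn hpn hscalar hρn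
  obtain ⟨e⟩ := hA
  obtain ⟨θ, hθ, hθn⟩ := exists_character_of_scalar e ρ₀ hscalar hn hρn
  exact restrict_galoisGroupAbove_H2_subsingleton_of_scalar hT4 hT3 hp.ne' hSf hS κ₁ κ₂
    (cyclotomicCharacter_mem_torsion_of_mem_multiZpKer hK hκ)
    ⟨e.toAddEquiv.trans (QpModZp.addEquivQuotientSubring p)⟩ ρ₀ θ hθ
    (coprime_card_range_of_pow_eq_one θ.toMonoidHom hn hpn hθn)

end Verbatim

/-! ### §6. (T3) is KERNEL in degree 2: the road modulo (T4) ALONE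
### (tree `ConjugationDescent.resSubgroup_two_injective` + `ContinuousCohomologyRestrictScalars`) -/

section KernelDescent

variable {K : Type} [Field K] [NumberField K] {p : ℕ} [Fact p.Prime]
  {S : Set (HeightOneSpectrum (𝓞 K))}

/-- **Multiplication by an integer prime to `p` is bijective on a `ℤ_p`-module** (`d` is a unit of
`ℤ_p`: `‖d‖ = 1`). This is the hypothesis "`(G : N)` invertible on `M`" of the tree's
`resSubgroup_two_injective` for a `p`-primary `M` — Serre's "composante `p`-primaire" clause.
[cite: SerreGaloisCohomology1997, Ch. I §2.4 (Corollaire to Prop. 9)] -/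
theorem bijective_zsmul_of_coprime {A : Type*} [AddCommGroup A] [Module ℤ_[p] A] {d : ℕ}
    (hd : Nat.Coprime d p) : Function.Bijective fun m : A ↦ (d : ℤ) • m := by
  have hu : IsUnit ((d : ℤ) : ℤ_[p]) := by
    rw [PadicInt.isUnit_iff]
    by_contra h
    have hlt : ‖((d : ℤ) : ℤ_[p])‖ < 1 := lt_of_le_of_ne (PadicInt.norm_le_one _) h
    rw [PadicInt.norm_int_lt_one_iff_dvd, Int.natCast_dvd_natCast] at hlt
    exact ((Fact.out : p.Prime).coprime_iff_not_dvd.mp (Nat.coprime_comm.mp hd)) hlt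
  obtain ⟨u, hu'⟩ := hu
  have hfun : (fun m : A ↦ (d : ℤ) • m) = fun m ↦ u • m := by
    funext m
    rw [Units.smul_def, hu', Int.cast_smul_eq_zsmul]
  rw [hfun]
  exact MulAction.bijective u

omit [Fact p.Prime] in
/-- A group additively isomorphic to `ℚ_p ⧸ ℤ_p` is `p`-power torsion (the hypothesis `hA` of
[Gr4] Thm. 3's reading `thm3_twistDeformation_cohomology_addEquiv.subsingleton`).
[cite: Greenberg2006, pp. 343–344 (`D = ℚ_p/ℤ_p`)] -/
theorem exists_pow_zsmul_eq_zero_of_addEquiv [Fact p.Prime] {A : Type*} [AddCommGroup A]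
    (e : A ≃+ ℚ_[p] ⧸ (PadicInt.subring p).toAddSubgroup) (a : A) : ∃ n : ℕ, (p ^ n : ℤ) • a = 0 := by
  obtain ⟨n, hn⟩ := QpModZp.exists_pow_zsmul_eq_zero p ((QpModZp.addEquivQuotientSubring p).symm (e a))
  refine ⟨n, e.injective ((QpModZp.addEquivQuotientSubring p).symm.injective ?_)⟩
  rw [map_zsmul, map_zsmul, hn, map_zero, map_zero]

/-- **The vanishing `H²(K_Σ/K̃_∞, A) = 0` for a corank-one coefficient twisted by a character of order
prime to `p`, MODULO (T4) ALONE** — general scalar model as in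
`restrict_galoisGroupAbove_H2_subsingleton_of_scalar`, WITHOUT the (T3) binder: weak Leopoldt over
`K_θ` ((T4) at `U₀ := π⁻¹(ker θ)`, `R := ℤ`, `D := A`) + transport along
`Gal(K_Σ/K̃_∞K_θ) ≅ U'' := ker(θ|Gal(K_Σ/K̃_∞))` (on `U''` the module IS trivial) + Serre I §2.4
Prop. 9 in degree 2 AS A KERNEL THEOREM: `U''` is an open normal subgroup of the profinite
`Gal(K_Σ/K̃_∞)` of index `#θ(Gal(K_Σ/K̃_∞)) ∣ #im θ` prime to `p`, hence invertible on the
`ℤ_p`-module `A` (`bijective_zsmul_of_coprime`), so `res : H²(Gal(K_Σ/K̃_∞), A) → H²(U'', A)` is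
injective over `ℤ` (tree `ConjugationDescent.resSubgroup_two_injective`, dimension shifting through the
acyclic coinduced module) — and `H² = 0` does not see the scalars
(`ContinuousRep.subsingleton_H_two_restrictScalars_iff`, p527318).
[cite: Greenberg2006, pp. 343–344, Thm. 3 p. 342, p. 342 L2–5]
[cite: SerreGaloisCohomology1997, Ch. I §2.4, Proposition 9 and Corollaire; Ch. I §2.6 (b)] -/
theorem restrict_galoisGroupAbove_H2_subsingleton_of_T4
    (hT4 : weakLeopoldt_H2_subsingleton_above_cyclotomic_of_isOpen)
    (hp : p ≠ 2) (hSf : S.Finite)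
    (hS : ∀ v : HeightOneSpectrum (𝓞 K), ((p : ℕ) : 𝓞 K) ∈ v.asIdeal → v ∈ S)
    (κ₁ κ₂ : ZpExtension K p)
    (hcyc : ∀ σ : absoluteGaloisGroup K, σ ∈ multiZpKer p ![κ₁, κ₂] →
      GaloisRep.cyclotomicCharacter K p σ ∈ CommGroup.torsion ℤ_[p]ˣ)
    {A : Type} [AddCommGroup A] [Module ℤ_[p] A] [TopologicalSpace A] [DiscreteTopology A]
    [ContinuousSMul ℤ_[p] A] (hA : Nonempty (A ≃+ ℚ_[p] ⧸ (PadicInt.subring p).toAddSubgroup))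
    (ρ₀ : ContinuousRep (GaloisGroupUnramifiedOutside K S) ℤ_[p] A)
    (θ : GaloisGroupUnramifiedOutside K S →ₜ* ℤ_[p]ˣ)
    (hρ₀ : ∀ (g : GaloisGroupUnramifiedOutside K S) (a : A), ρ₀ g a = ((θ g : ℤ_[p]ˣ) : ℤ_[p]) • a)
    (hθ : Nat.Coprime (Nat.card θ.toMonoidHom.range) p) :
    Subsingleton ((ρ₀.restrict (galoisGroupAboveSubtype S (multiZpKer p ![κ₁, κ₂]))).H 2) := by
  -- notation
  set Hsub : Subgroup (absoluteGaloisGroup K) := multiZpKer p ![κ₁, κ₂] with hHsub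
  set Ginf : Subgroup (GaloisGroupUnramifiedOutside K S) := galoisGroupAbove S Hsub with hGinf
  set ι : Ginf →ₜ* GaloisGroupUnramifiedOutside K S := galoisGroupAboveSubtype S Hsub with hι
  set Kθ : Subgroup (GaloisGroupUnramifiedOutside K S) := θ.toMonoidHom.ker with hKθ
  set U₀ : Subgroup (absoluteGaloisGroup K) := Kθ.comap (toUnramifiedQuot K S) with hU₀
  -- the image of `θ` is finite, its kernel open
  have hfin : (Set.range θ).Finite := finite_range_of_coprime θ hθ
  have hKθopen : IsOpen (Kθ : Set (GaloisGroupUnramifiedOutside K S)) :=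
    continuousMonoidHom_isOpen_ker_of_finite_range θ hfin
  have hU₀open : IsOpen (U₀ : Set (absoluteGaloisGroup K)) :=
    hKθopen.preimage (continuous_toUnramifiedQuot K S)
  have hN : ramificationSubgroup K S ≤ U₀ := fun σ hσ ↦ by
    rw [Subgroup.mem_comap, MonoidHom.mem_ker]
    have h1 : toUnramifiedQuot K S σ = 1 := (QuotientGroup.eq_one_iff σ).mpr hσ
    rw [h1, map_one]
  -- (T4) over `R := ℤ`: weak Leopoldt over `K_θ` inside `Γ_K`
  have hwl : Subsingleton ((ContinuousRep.trivial (galoisGroupAbove S (U₀ ⊓ Hsub)) ℤ A).H 2) :=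
    hT4 K p hp S hSf hS 2 ![κ₁, κ₂] U₀ hU₀open hN (fun σ hσ ↦ hcyc σ hσ.2) ℤ A hA
  -- the subgroup of `Ginf` killed by `θ`: open, NORMAL, of index prime to `p`
  set U'' : Subgroup Ginf := (θ.comp ι).toMonoidHom.ker with hU''
  haveI hU''normal : U''.Normal := by rw [hU'']; infer_instance
  have hU''eq : U'' = (Kθ ⊓ Ginf).subgroupOf Ginf := by
    ext u
    simp only [hU'', MonoidHom.mem_ker, ContinuousMonoidHom.coe_toMonoidHom,
      Subgroup.mem_subgroupOf, Subgroup.mem_inf, hKθ, SetLike.coe_mem, and_true]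
    rfl
  have hU'eq : galoisGroupAbove S (U₀ ⊓ Hsub) = Kθ ⊓ Ginf := galoisGroupAbove_comap_inf θ Hsub
  -- `U'' ≃ₜ* galoisGroupAbove S (U₀ ⊓ Hsub)`
  let e₀ : U'' ≃* (galoisGroupAbove S (U₀ ⊓ Hsub)) :=
    ((MulEquiv.subgroupCongr hU''eq).trans (Subgroup.subgroupOfEquivOfLe inf_le_right)).trans
      (MulEquiv.subgroupCongr hU'eq.symm)
  have he₀ : ∀ u : U'', ((e₀ u : galoisGroupAbove S (U₀ ⊓ Hsub)) : GaloisGroupUnramifiedOutside K S) =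
      ((u : Ginf) : GaloisGroupUnramifiedOutside K S) := fun _ ↦ rfl
  have he₀' : ∀ v : galoisGroupAbove S (U₀ ⊓ Hsub),
      (((e₀.symm v : U'') : Ginf) : GaloisGroupUnramifiedOutside K S) =
        (v : GaloisGroupUnramifiedOutside K S) := fun _ ↦ rfl
  let e : U'' ≃ₜ* (galoisGroupAbove S (U₀ ⊓ Hsub)) :=
    { e₀ with
      continuous_toFun := by
        refine Topology.IsInducing.subtypeVal.continuous_iff.mpr ?_
        show Continuous fun u : U'' ↦
          ((e₀ u : galoisGroupAbove S (U₀ ⊓ Hsub)) : GaloisGroupUnramifiedOutside K S)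
        simp_rw [he₀]
        exact continuous_subtype_val.comp continuous_subtype_val
      continuous_invFun := by
        refine Topology.IsInducing.subtypeVal.continuous_iff.mpr
          (Topology.IsInducing.subtypeVal.continuous_iff.mpr ?_)
        show Continuous fun v : galoisGroupAbove S (U₀ ⊓ Hsub) ↦
          (((e₀.symm v : U'') : Ginf) : GaloisGroupUnramifiedOutside K S)
        simp_rw [he₀']
        exact continuous_subtype_val }
  -- transport the vanishing to `U''` with the trivial action (over `ℤ`)
  have htrivU'' : Subsingleton ((ContinuousRep.trivial U'' ℤ A).H 2) := by
    haveI : Subsingleton (continuousCohomology 2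
        (ContinuousRep.trivial (galoisGroupAbove S (U₀ ⊓ Hsub)) ℤ A).toTopRep) := hwl
    exact subsingleton_continuousCohomology_of_continuousMulEquiv e
      (X := (ContinuousRep.trivial U'' ℤ A).toTopRep)
      (Y := (ContinuousRep.trivial (galoisGroupAbove S (U₀ ⊓ Hsub)) ℤ A).toTopRep)
      (TopRep.ofHom ⟨ContinuousLinearMap.id ℤ A, fun _ ↦ rfl⟩)
      (TopRep.ofHom ⟨ContinuousLinearMap.id ℤ A, fun _ ↦ rfl⟩)
      (fun _ ↦ rfl) 2
  -- the `ℤ`-linear representation of `Gal(K_Σ/K̃_∞)` on `A`; its restriction to `U''` is trivial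
  set ρZ : ContinuousRep Ginf ℤ A := (ρ₀.restrict ι).restrictScalars ℤ with hρZ
  have hrestr : ρZ.restrict ⟨U''.subtype, continuous_subtype_val⟩ =
      ContinuousRep.trivial U'' ℤ A := by
    refine ContinuousRep.ext fun u ↦ LinearMap.ext fun a ↦ ?_
    have hu : θ (ι (u : Ginf)) = 1 := u.2
    change ρ₀ (ι (u : Ginf)) a = a
    rw [hρ₀, hu, Units.val_one, one_smul]
  -- profinite `Ginf`; `U''` open of finite index prime to `p`
  haveI : CompactSpace Ginf := compactSpace_galoisGroupAbove S Hsub (isClosed_multiZpKer p _)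
  haveI : TotallyDisconnectedSpace (GaloisGroupUnramifiedOutside K S) :=
    totallyDisconnectedSpace_galoisGroupUnramifiedOutside S
  have hU''open : IsOpen (U'' : Set Ginf) := by
    refine continuousMonoidHom_isOpen_ker_of_finite_range (θ.comp ι) (hfin.subset ?_)
    rintro _ ⟨u, rfl⟩
    exact ⟨ι u, rfl⟩
  have hU''cop : Nat.Coprime U''.index p := by
    rw [hU'', Subgroup.index_ker]
    refine Nat.Coprime.coprime_dvd_left (Subgroup.card_dvd_of_le ?_) hθ
    rintro _ ⟨u, rfl⟩
    exact ⟨ι u, rfl⟩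
  haveI : U''.FiniteIndex := ⟨index_ne_zero_of_isOpen U'' hU''open⟩
  haveI : Fintype (Ginf ⧸ U'') := Subgroup.fintypeQuotientOfFiniteIndex
  -- Serre I §2.4 Prop. 9 in degree 2, KERNEL: `res : H²(Ginf, A) → H²(U'', A)` injective over `ℤ`
  have hinj := resSubgroup_two_injective U'' ρZ hU''open (bijective_zsmul_of_coprime hU''cop)
  haveI : Subsingleton (continuousCohomology 2 (subgroupRep ρZ.toTopRep U'')) := by
    change Subsingleton ((ρZ.restrict ⟨U''.subtype, continuous_subtype_val⟩).H 2)
    rw [hrestr]; exact htrivU''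
  have hZ : Subsingleton (ρZ.H 2) := hinj.subsingleton
  -- back to `ℤ_p`-linear cohomology
  exact (ContinuousRep.subsingleton_H_two_restrictScalars_iff ℤ (ρ₀.restrict ι)).1 hZ

variable [TopologicalSpace (PowerSeries ℤ_[p])] [TopologicalSpace (PowerSeries (PowerSeries ℤ_[p]))]

/-- **`H²(K_Σ/K, Ind_{K̃_∞/K} A) = 0`, general scalar model, MODULO (T4) ALONE**:
`A` discrete `≃+ ℚ_p/ℤ_p`, `ρ₀ g a = θ g • a` for a continuous `θ : G_{K,S} →ₜ* ℤ_pˣ` with `#im θ`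
prime to `p`, `(κ₁, κ₂)` jointly onto `ℤ_p²` with `K̃_∞ ⊇ K^{cyc}`, `p` odd. [Gr4] Thm. 3 in degree 2
enters as ARM P r13's KERNEL theorem `twistDeformation_H_two_subsingleton_of_subsingleton_above`
(p530931: Faddeev–Shapiro for the closed `Gal(K_Σ/K̃_∞)` + the model isomorphism `𝐃 ≅ M_G^H(A)`),
no longer as the named fact `thm3_twistDeformation_cohomology_addEquiv`. The data of
`twistDeformation_H2_subsingleton_of_character` / `_of_unitChar` are instances
(`hρ₀ := QpModZp.characterRep_apply θ`). [cite: Greenberg2006, Thm. 3 p. 342, pp. 343–344]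
[cite: SerreGaloisCohomology1997, Ch. I §2.4, Proposition 9; Ch. I §2.5, Proposition 10] -/
theorem twistDeformation_H2_subsingleton_of_T4
    (hT4 : weakLeopoldt_H2_subsingleton_above_cyclotomic_of_isOpen)
    (hp : p ≠ 2) (hSf : S.Finite)
    (hS : ∀ v : HeightOneSpectrum (𝓞 K), ((p : ℕ) : 𝓞 K) ∈ v.asIdeal → v ∈ S)
    {κ₁ κ₂ : ZpExtension K p}
    (hκ : Function.Surjective (fun σ : absoluteGaloisGroup K ↦ (κ₁ σ, κ₂ σ)))
    (hcyc : ∀ σ : absoluteGaloisGroup K, σ ∈ multiZpKer p ![κ₁, κ₂] →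
      GaloisRep.cyclotomicCharacter K p σ ∈ CommGroup.torsion ℤ_[p]ˣ)
    {A : Type} [AddCommGroup A] [Module ℤ_[p] A] [TopologicalSpace A] [DiscreteTopology A]
    [ContinuousSMul ℤ_[p] A] (hA : Nonempty (A ≃+ ℚ_[p] ⧸ (PadicInt.subring p).toAddSubgroup))
    (ρ₀ : ContinuousRep (GaloisGroupUnramifiedOutside K S) ℤ_[p] A)
    (θ : GaloisGroupUnramifiedOutside K S →ₜ* ℤ_[p]ˣ)
    (hρ₀ : ∀ (g : GaloisGroupUnramifiedOutside K S) (a : A), ρ₀ g a = ((θ g : ℤ_[p]ˣ) : ℤ_[p]) • a)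
    (hθ : Nat.Coprime (Nat.card θ.toMonoidHom.range) p)
    [ContinuousSMul (PowerSeries (PowerSeries ℤ_[p])) (IndModule₂ ℤ_[p] p A)] :
    Subsingleton ((twistDeformation S hS κ₁ κ₂ ρ₀).H 2) :=
  twistDeformation_H_two_subsingleton_of_subsingleton_above hS κ₁ κ₂ hκ ρ₀
    (exists_pow_zsmul_eq_zero_of_addEquiv hA.some)
    (restrict_galoisGroupAbove_H2_subsingleton_of_T4 hT4 hp hSf hS κ₁ κ₂ hcyc hA ρ₀ θ hρ₀ hθ)

/-- **LEO(`𝐃`) for the general scalar model, MODULO (T4) ALONE** (binder `hLEO` of the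
cell's instance theorem `…TwistDeformationFullAtSelmer.twistDeformation_fullAtSelmer_isAlmostDivisible`).
[cite: Greenberg2016Selmer, §2.2 p. 6 L22–30 (LEO(𝐃))] [cite: Greenberg2006, pp. 343–344, Thm. 3 p. 342] -/
theorem twistDeformation_LEO_of_T4
    (hT4 : weakLeopoldt_H2_subsingleton_above_cyclotomic_of_isOpen)
    (hp : p ≠ 2) (hSf : S.Finite)
    (hS : ∀ v : HeightOneSpectrum (𝓞 K), ((p : ℕ) : 𝓞 K) ∈ v.asIdeal → v ∈ S)
    {κ₁ κ₂ : ZpExtension K p}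
    (hκ : Function.Surjective (fun σ : absoluteGaloisGroup K ↦ (κ₁ σ, κ₂ σ)))
    (hcyc : ∀ σ : absoluteGaloisGroup K, σ ∈ multiZpKer p ![κ₁, κ₂] →
      GaloisRep.cyclotomicCharacter K p σ ∈ CommGroup.torsion ℤ_[p]ˣ)
    {A : Type} [AddCommGroup A] [Module ℤ_[p] A] [TopologicalSpace A] [DiscreteTopology A]
    [ContinuousSMul ℤ_[p] A] (hA : Nonempty (A ≃+ ℚ_[p] ⧸ (PadicInt.subring p).toAddSubgroup))
    (ρ₀ : ContinuousRep (GaloisGroupUnramifiedOutside K S) ℤ_[p] A)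
    (θ : GaloisGroupUnramifiedOutside K S →ₜ* ℤ_[p]ˣ)
    (hρ₀ : ∀ (g : GaloisGroupUnramifiedOutside K S) (a : A), ρ₀ g a = ((θ g : ℤ_[p]ˣ) : ℤ_[p]) • a)
    (hθ : Nat.Coprime (Nat.card θ.toMonoidHom.range) p)
    [IsTopologicalAddGroup (IndModule₂ ℤ_[p] p A)]
    [ContinuousSMul (PowerSeries (PowerSeries ℤ_[p])) (IndModule₂ ℤ_[p] p A)] :
    LEO S (twistDeformation S hS κ₁ κ₂ ρ₀) := by
  haveI := twistDeformation_H2_subsingleton_of_T4 hT4 hp hSf hS hκ hcyc hA ρ₀ θ hρ₀ hθ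
  haveI : Subsingleton (sha2 S (twistDeformation S hS κ₁ κ₂ ρ₀)) :=
    ⟨fun a b ↦ Subtype.ext (Subsingleton.elim _ _)⟩
  exact isCotorsion_of_subsingleton

/-- **`corank_{Λ₂} H²(K_Σ/K, 𝐃) = 0` for the general scalar model, MODULO (T4) ALONE**
(binder `h2` of the cell's instance theorem). [cite: Greenberg2016Selmer, §2.3 p. 7 L1–17 (coranks)]
[cite: Greenberg2006, pp. 343–344, Thm. 3 p. 342] -/
theorem twistDeformation_hasCorank_H2_zero_of_T4
    (hT4 : weakLeopoldt_H2_subsingleton_above_cyclotomic_of_isOpen)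
    (hp : p ≠ 2) (hSf : S.Finite)
    (hS : ∀ v : HeightOneSpectrum (𝓞 K), ((p : ℕ) : 𝓞 K) ∈ v.asIdeal → v ∈ S)
    {κ₁ κ₂ : ZpExtension K p}
    (hκ : Function.Surjective (fun σ : absoluteGaloisGroup K ↦ (κ₁ σ, κ₂ σ)))
    (hcyc : ∀ σ : absoluteGaloisGroup K, σ ∈ multiZpKer p ![κ₁, κ₂] →
      GaloisRep.cyclotomicCharacter K p σ ∈ CommGroup.torsion ℤ_[p]ˣ)
    {A : Type} [AddCommGroup A] [Module ℤ_[p] A] [TopologicalSpace A] [DiscreteTopology A]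
    [ContinuousSMul ℤ_[p] A] (hA : Nonempty (A ≃+ ℚ_[p] ⧸ (PadicInt.subring p).toAddSubgroup))
    (ρ₀ : ContinuousRep (GaloisGroupUnramifiedOutside K S) ℤ_[p] A)
    (θ : GaloisGroupUnramifiedOutside K S →ₜ* ℤ_[p]ˣ)
    (hρ₀ : ∀ (g : GaloisGroupUnramifiedOutside K S) (a : A), ρ₀ g a = ((θ g : ℤ_[p]ˣ) : ℤ_[p]) • a)
    (hθ : Nat.Coprime (Nat.card θ.toMonoidHom.range) p)
    [ContinuousSMul (PowerSeries (PowerSeries ℤ_[p])) (IndModule₂ ℤ_[p] p A)] :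
    HasCorank (PowerSeries (PowerSeries ℤ_[p])) ((twistDeformation S hS κ₁ κ₂ ρ₀).H 2) 0 := by
  haveI := twistDeformation_H2_subsingleton_of_T4 hT4 hp hSf hS hκ hcyc hA ρ₀ θ hρ₀ hθ
  exact hasCorank_zero_of_subsingleton

end KernelDescent

section KellerYinT4

open Literature.NumberTheory.EllipticCurves Literature.NumberTheory.EllipticCurves.KellerYin2024

variable {K : Type} [Field K] [NumberField K] {p : ℕ} [Fact p.Prime]
  (S : Set (HeightOneSpectrum (𝓞 K)))
  (θ : FramedGaloisRep K (padicCoeffIntegers (∅ : Set (PadicAlgCl p))) 1)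
  [TopologicalSpace (PowerSeries ℤ_[p])] [TopologicalSpace (PowerSeries (PowerSeries ℤ_[p]))]

/-- **LEO(`𝐃_θ`) for Keller–Yin's character, MODULO (T4) ALONE** — the binder `hLEO` of the cell's
instance theorem at the NAMED MODEL `ρ₀ := characterRepUnramified S θ h` (`A := QpModZp p`), from
`twistDeformation_LEO_of_T4` (the (hT3)/(h3)-free §6 road) at `θ̃ := liftUnramifiedCont S (unitChar θ) h`.
[cite: Greenberg2016Selmer, §2.2 p. 6 L22–30] [cite: KellerYin2024, §1.1]
[cite: Greenberg2006, Thm. 3 p. 342, pp. 343–344] -/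
theorem twistDeformation_LEO_of_unitChar_of_T4
    (hT4 : weakLeopoldt_H2_subsingleton_above_cyclotomic_of_isOpen)
    (hp : p ≠ 2) (hSf : S.Finite)
    (hS : ∀ v : HeightOneSpectrum (𝓞 K), ((p : ℕ) : 𝓞 K) ∈ v.asIdeal → v ∈ S)
    {κ₁ κ₂ : ZpExtension K p}
    (hκ : Function.Surjective (fun σ : absoluteGaloisGroup K ↦ (κ₁ σ, κ₂ σ)))
    (hcyc : ∀ σ : absoluteGaloisGroup K, σ ∈ multiZpKer p ![κ₁, κ₂] →
      GaloisRep.cyclotomicCharacter K p σ ∈ CommGroup.torsion ℤ_[p]ˣ)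
    (h : ramificationSubgroup K S ≤ (unitChar θ).toMonoidHom.ker) {n : ℕ} (hn : 0 < n)
    (hpn : ¬ p ∣ n) (hθ : ∀ σ : absoluteGaloisGroup K, θ σ ^ n = 1)
    [DiscreteTopology (QpModZp p)] [ContinuousSMul ℤ_[p] (QpModZp p)]
    [IsTopologicalAddGroup (IndModule₂ ℤ_[p] p (QpModZp p))]
    [ContinuousSMul (PowerSeries (PowerSeries ℤ_[p])) (IndModule₂ ℤ_[p] p (QpModZp p))] :
    LEO S (twistDeformation S hS κ₁ κ₂ (characterRepUnramified S θ h)) :=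
  twistDeformation_LEO_of_T4 hT4 hp hSf hS hκ hcyc ⟨QpModZp.addEquivQuotientSubring p⟩
    (characterRepUnramified S θ h) (liftUnramifiedCont S (unitChar θ) h) (fun _ _ ↦ rfl)
    (coprime_card_range_liftUnramifiedCont_unitChar S θ h hn hpn hθ)

/-- **`corank H²(K_Σ/K, 𝐃_θ) = 0` for Keller–Yin's character, MODULO (T4) ALONE** — the binder `h2` of
the cell's instance theorem at `ρ₀ := characterRepUnramified S θ h`.
[cite: Greenberg2016Selmer, §2.3 p. 7 L1–17] [cite: KellerYin2024, §1.1]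
[cite: Greenberg2006, Thm. 3 p. 342, pp. 343–344] -/
theorem twistDeformation_hasCorank_H2_zero_of_unitChar_of_T4
    (hT4 : weakLeopoldt_H2_subsingleton_above_cyclotomic_of_isOpen)
    (hp : p ≠ 2) (hSf : S.Finite)
    (hS : ∀ v : HeightOneSpectrum (𝓞 K), ((p : ℕ) : 𝓞 K) ∈ v.asIdeal → v ∈ S)
    {κ₁ κ₂ : ZpExtension K p}
    (hκ : Function.Surjective (fun σ : absoluteGaloisGroup K ↦ (κ₁ σ, κ₂ σ)))
    (hcyc : ∀ σ : absoluteGaloisGroup K, σ ∈ multiZpKer p ![κ₁, κ₂] →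
      GaloisRep.cyclotomicCharacter K p σ ∈ CommGroup.torsion ℤ_[p]ˣ)
    (h : ramificationSubgroup K S ≤ (unitChar θ).toMonoidHom.ker) {n : ℕ} (hn : 0 < n)
    (hpn : ¬ p ∣ n) (hθ : ∀ σ : absoluteGaloisGroup K, θ σ ^ n = 1)
    [DiscreteTopology (QpModZp p)] [ContinuousSMul ℤ_[p] (QpModZp p)]
    [ContinuousSMul (PowerSeries (PowerSeries ℤ_[p])) (IndModule₂ ℤ_[p] p (QpModZp p))] :
    HasCorank (PowerSeries (PowerSeries ℤ_[p]))
      ((twistDeformation S hS κ₁ κ₂ (characterRepUnramified S θ h)).H 2) 0 :=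
  twistDeformation_hasCorank_H2_zero_of_T4 hT4 hp hSf hS hκ hcyc ⟨QpModZp.addEquivQuotientSubring p⟩
    (characterRepUnramified S θ h) (liftUnramifiedCont S (unitChar θ) h) (fun _ _ ↦ rfl)
    (coprime_card_range_liftUnramifiedCont_unitChar S θ h hn hpn hθ)

end KellerYinT4

section VerbatimKernel

open Literature.NumberTheory.EllipticCurves

/-- **`stub_weakLeopoldtAbove` (skeleton `halves` v6, stub 5) VERBATIM, from (T4) ALONE** — the same
statement as `weakLeopoldtAbove_of_facts`, without the (T3) binder (§6: Serre I §2.4 Prop. 9 in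
degree 2 is the tree's kernel theorem `resSubgroup_two_injective`). The closer of the stub is
`exact weakLeopoldtAbove_of_T4 hT4`; conditional on the single PUBLISHED fact (T4)
`weakLeopoldt_H2_subsingleton_above_cyclotomic_of_isOpen` ([Gr4] pp. 343–344 = [NQD84] Thm. 2.2 +
Iwasawa 1973, p528392). [cite: Greenberg2006, pp. 343–344, Thm. 3 p. 342]
[cite: NguyenQuangDo1984, Thm. 2.2] [cite: SerreGaloisCohomology1997, Ch. I §2.4, Proposition 9]
[cite: Washington1997, Thm. 13.4] -/
theorem weakLeopoldtAbove_of_T4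
    (hT4 : weakLeopoldt_H2_subsingleton_above_cyclotomic_of_isOpen) :
    ∀ (p : ℕ) [Fact p.Prime] (K : Type) [Field K] [NumberField K], 2 < p →
      IsImaginaryQuadratic K →
      ∀ (S : Set (HeightOneSpectrum (𝓞 K))), S.Finite →
        (∀ v : HeightOneSpectrum (𝓞 K), ((p : ℕ) : 𝓞 K) ∈ v.asIdeal → v ∈ S) →
      ∀ (κ₁ κ₂ : ZpExtension K p),
        (Function.Surjective fun σ : absoluteGaloisGroup K ↦ (κ₁ σ, κ₂ σ)) →
      ∀ (A : Type) [AddCommGroup A] [Module ℤ_[p] A] [TopologicalSpace A] [DiscreteTopology A]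
        [ContinuousSMul ℤ_[p] A], Nonempty (A ≃ₗ[ℤ_[p]] QpModZp p) →
      ∀ (ρ₀ : ContinuousRep (GaloisGroupUnramifiedOutside K S) ℤ_[p] A) (n : ℕ), 0 < n → ¬ p ∣ n →
        (∀ g : GaloisGroupUnramifiedOutside K S, ∃ t : ℤ_[p]ˣ, ∀ a : A, ρ₀ g a = (t : ℤ_[p]) • a) →
        (∀ g : GaloisGroupUnramifiedOutside K S, ρ₀ g ^ n = 1) →
      Subsingleton ((ρ₀.restrict (galoisGroupAboveSubtype S (multiZpKer p ![κ₁, κ₂]))).H 2) := by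
  intro p _ K _ _ hp hK S hSf hS κ₁ κ₂ hκ A _ _ _ _ _ hA ρ₀ n hn hpn hscalar hρn
  obtain ⟨e⟩ := hA
  obtain ⟨θ, hθ, hθn⟩ := exists_character_of_scalar e ρ₀ hscalar hn hρn
  exact restrict_galoisGroupAbove_H2_subsingleton_of_T4 hT4 hp.ne' hSf hS κ₁ κ₂
    (cyclotomicCharacter_mem_torsion_of_mem_multiZpKer hK hκ)
    ⟨e.toAddEquiv.trans (QpModZp.addEquivQuotientSubring p)⟩ ρ₀ θ hθ
    (coprime_card_range_of_pow_eq_one θ.toMonoidHom hn hpn hθn)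

end VerbatimKernel

end Literature.NumberTheory.IwasawaTheory.Greenberg2006

end
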